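import Literature.Probability.RandomPlanarGeometry.HexSAWStripCutCrossings
import HarnessLib

/-!
# The irreducible bridges of the width-three honeycomb strip `S₃` — ten short bridges and two serpentine families — and its
# irreducible kernel in closed form: a RATIONAL `6 × 6` matrix (module «WIDTH-THREE-KERNEL»)

Topic `Literature/Probability/RandomPlanarGeometry` (continues «STRIP-CUT-CROSSINGS» `HexSAWStripCutCrossings.lean`: three crossings of every
internal cut, the rails of `S₃`, `W3.trav_even/odd`, the forcing tools; «WIDTH-TWO-KERNEL» `HexSAWStripWidthTwoKernel.lean` #715: the six short
lists `W2.irr01 … W2.irr31`, `W2.adj_*_iff`, `W2.not_isRenewalIdx_of_npieces`; «BRIDGE-RENEWAL» `HexSAWStripBridgeRenewal.lean`: `HV.HBk`,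
`HV.wD`, `HV.npieces`).  Lane «pcv-sawmu» (CriticalPhenomena venture), a-p2 g25, HANDOFF-gen24 §Recommended 4 («WIDTH-THREE-KERNEL»; the
conjecture and its numerics — kit job j273139, all irreducible bridges of `S₃` with `≤ 35` vertices — are a-p2 g24's).  Sources of the
SETTING: H. Duminil-Copin, A. Hammond, CMP 324 (2013) §2.2 (bridges, renewal points, irreducible bridges); H. Duminil-Copin, S. Smirnov,
Ann. Math. 175 (2012) §3 (the strip `S_T`, Fig. 3); N. R. Beaton, M. Bousquet-Mélou, J. de Gier, H. Duminil-Copin, A. J. Guttmann, CMP 326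
(2014) §3.2, §4 (surface fugacity `y`, weights `x^{|γ|} y^{contacts}`).  Nothing below is printed: for `T ≥ 3` the printed treatments of
strips are transfer matrices (Beaton–Guttmann–Jensen 2012); the classification is this lane's own theorem.

## What is proved (namespace `Literature.Probability.RandomPlanarGeometry.SAW.HV.W3`; levels `0…5`, columns `ξ`, rails `b = x₁ ∈ {0,1,2}`)

* §5 CASE A (head `(0,0,t)`, level 1, then the lonely level-0 vertex `(1,0,f)` of column 2, last column `ξ_end ≥ 3`): `caseA_rail0` (the walk
  follows rail 0 rightward while `ξ < ξ_end`: every rail edge across an internal cut is traversed, and the walk sits at its left end),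
  `caseA_odd` (`ξ_end = 2K+1`: at an even last column rail 0 would dead-end at level 0 before rail 1 is used), `caseA_turn1` (rung `(K,0,t)→(K,1,f)`),
  `caseA_rail1` (rail 1 leftward to column 2), `caseA_turn2` (rung `(0,1,t)→(0,2,f)`), `caseA_rail2` (rail 2 rightward), `caseA_length` (`6K+1`
  vertices: `(K−1,2,t)` is a dead end).
* §6 `rail0L/rail1L/rail2L`, ★ `serpUp K = (0,0,t) :: (rail0L K ++ rail1L K ++ rail2L K)` and ★★ `caseA_eq_serpUp`: such a bridge IS `serpUp K`.
* §7 `serpUp_isChain/nodup/inLev/isHBridge/not_isRenewalIdx`, `topCnt_serpUp_tail = K`, `wD_serpUp : wD 3 y (serpUp K) = x_c^{6K} y^K`, and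
  ★★ `serpUp_mem_HBk : serpUp K ∈ HBk 3 N 1 1 5` (`K ≥ 1`, `6K ≤ N`).
* §8 the half-turn `flipA : (a,b,c) ↦ (a+b+bit−1, 2−b, ¬c)` of `S₃` (levels `L ↦ 5−L`, columns `ξ ↦ ξ+1`) and its inverse `flipB`, the
  `transport` lemma (chain / self-avoidance / `InLev 3` / bridge / irreducibility transfer), ★ `serpDn K := (serpUp K).map flipA` (`4 → 0`),
  ★★ `caseB_eq_serpDn` (head `(0,2,f)` then `(0,2,t)`, `ξ_end ≥ 4` ⇒ `l = serpDn K`, `ξ_end = 2K+2`), `topCnt_serpDn_tail = K`, `wD_serpDn`,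
  ★★ `serpDn_mem_HBk : serpDn K ∈ HBk 3 N 1 4 0`.
* §9 the four new short lists `irr24`, `irr45`, `irr54`, `irr53` and ★★★ **`mem_HBk_three_one` — CLASSIFICATION: every member of `HBk 3 N 1 a b`
  (irreducible standard horizontal bridge of `S₃`, level `a → b`) is one of the TEN short lists `0→1`, `0→2`, `1→0`, `2→3`, `2→4`, `3→2`, `3→1`,
  `4→5`, `5→4`, `5→3` (one slant, or a slant and a rung: lengths 1 and 2) or a SERPENTINE `serpUp K` (`1→5`) / `serpDn K` (`4→0`), `K ≥ 1`
  (`6K` steps, `K` top contacts, weight `x_c^{6K} y^K`)**.  Proof: the vertex after the head is forced; if it is a rung vertex of its column,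
  the lonely vertex of that column is a dead end strictly inside the bridge unless the bridge ends in that column (length `≤ 3`); if it is
  the lonely vertex, §5–§8.

* §10 the level classes as explicit finsets (`HBk_three_pair`, `HBk_three_triple(_lt)`, ★★ `HBk_three_serp : HBk 3 N 1 1 5 = {serpUp (K+1) : K < N/6}`
  (and `4 0` with `serpDn`), `HBk_three_empty` for the other 24 pairs), the weights `wD_irr`, the serpentine series `serpSum N y = Σ_{K<N/6} (x_c⁶y)^{K+1}`,
  ★★ **`kerThree s y = (0,x,x²,0,0,0 | x,0,0,0,0,s | 0,0,0,x,x²,0 | 0,x²,x,0,0,0 | s,0,0,0,0,xy | 0,0,0,x²,x,0)`**, ★★ `Imat_three_eq (hN : 2 ≤ N) :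
  Imat 3 N y = kerThree (serpSum N y) y`, `tendsto_serpSum`, and ★★★ **`Iinf_three_eq (hy : 0 ≤ y) (hy' : x_c⁶ y < 1) : Iinf 3 y = kerThree (x_c⁶y/(1 − x_c⁶y)) y`
  — THE IRREDUCIBLE KERNEL OF THE WIDTH-THREE STRIP IS RATIONAL**, analytic on `[0, x_c^{−6}) ⊃ [0, 39]`, far beyond the critical surface
  fugacity (`y₃ < y₂ = 3.04…`): every contact / length moment of the critical kernel of `S₃` is finite (the hypothesis hC2 of «CONTACT-LLN»
  #750 / «BETA-CONTACT-LLN» #770 at `T = 3`, to be instantiated with the Perron data of `kerThree` in a successor).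

Finite-data face: a-p2 g24's enumeration of all irreducible standard bridges of `S₃` with `≤ 35` vertices (kit job j273139): counts by steps
`{1: 6, 2: 4, 6: 2, 12: 2, 18: 2, 24: 2, 30: 2}`; lit-1 g30's independent enumerator from the tree definitions (2026-08-27, `≤ 37` vertices): 22
irreducible bridges = 10 short + 2 × {7, 13, 19, 25, 31, 37 vertices}, every internal cut crossed exactly thrice.  Label: LANE THEOREM (own result
of lane «pcv-sawmu», a-p2 g24 conjecture / a-p2 g25 proof, 2026-08-27).  NOT claimed: the Perron data of `kerThree` at `y₃` (`y₃` is cubic over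
`ℚ(√2)`: `(1 − x⁶y)²·det(1 − kerThree) = 0`), `θ₃`, `ν₃`; anything for `T ≥ 4`.
-/

noncomputable section

open Finset Filter Topology Literature.Probability.LatticeModels Literature.Probability.Percolation

namespace Literature.Probability.RandomPlanarGeometry.SAW

namespace HV

variable {l : List HV}

namespace W3

/-! ### §5 The long irreducible bridges entering at level 1: forcing along the three rails -/

/-- Head column of a list starting at `(0,0,t)` (plumbing). [cite: DuminilCopinSmirnov2012, §3 (Fig. 3); lane plumbing] -/
theorem xi_head_of_at_zero (hne : l ≠ []) {v : HV} (h0 : l[0]? = some v) : l.head hne = v := by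
  obtain ⟨h, e⟩ := List.getElem?_eq_some_iff.1 h0
  rw [List.head_eq_getElem, e]

/-- **Rail 0, rightward.**  An irreducible self-avoiding bridge of `S₃` starting `(0,0,t) → (1,0,f)` (level 1 → the lonely level-0
vertex of column 2) follows the bottom rail as long as it stays strictly left of its last column `ξ_end`: `l[2k+1] = (k+1,0,f)` while
`2k+2 ≤ ξ_end` and `l[2k+2] = (k+1,0,t)` while `2k+3 ≤ ξ_end`. [cite: DuminilCopinHammond2013, §2.2 (irreducible bridges); lane «pcv-sawmu» a-p2 g25 — own result] -/
theorem caseA_rail0 (hc : l.IsChain hvGraph.Adj) (hnd : l.Nodup) (hin : InLev 3 l) (hB : IsHBridge l)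
    (hirr : ∀ i, ¬ IsRenewalIdx l i) (h0 : l[0]? = some (0, 0, true)) (h1 : l[1]? = some (1, 0, false)) (k : ℕ) :
    ((2 * k + 2 : ℤ) ≤ xi (l.getLast hB.1) → l[2 * k + 1]? = some ((k : ℤ) + 1, 0, false)) ∧
    ((2 * k + 3 : ℤ) ≤ xi (l.getLast hB.1) → l[2 * k + 2]? = some ((k : ℤ) + 1, 0, true)) := by
  have hhead : xi (l.head hB.1) = 1 := by rw [xi_head_of_at_zero hB.1 h0]; simp [xi, bit]
  induction k with
  | zero =>
    refine ⟨fun _ => by simpa using h1, fun hE => ?_⟩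
    push_cast at hE
    obtain ⟨t0, -, -⟩ := trav_even hc hnd hin hB hirr 1 (by rw [hhead]; norm_num) (by omega)
    have := next_of_trav hnd t0 (m := 1) (by simpa using h1) (fun m' hm' => by
      obtain rfl : m' = 0 := by omega
      rw [h0]; simp)
    simpa using this
  | succ k ih =>
    obtain ⟨P, Q⟩ := ih
    have P' : (2 * ((k + 1 : ℕ) : ℤ) + 2 : ℤ) ≤ xi (l.getLast hB.1) → l[2 * (k + 1) + 1]? = some (((k + 1 : ℕ) : ℤ) + 1, 0, false) := by
      intro hE
      push_cast at hE
      have eq := Q (by omega)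
      have ep := P (by omega)
      obtain ⟨t0, -, -⟩ := trav_odd hc hnd hin hB hirr ((k : ℤ) + 1) (by rw [hhead]; omega) (by omega)
      have e := next_of_trav hnd t0 (m := 2 * k + 2) eq (fun m' hm' => by
        obtain rfl : m' = 2 * k + 1 := by omega
        rw [ep]; simp)
      rw [show 2 * (k + 1) + 1 = 2 * k + 2 + 1 by ring, e]; push_cast; ring_nf
    refine ⟨P', fun hE => ?_⟩
    push_cast at hE
    have ep : l[2 * k + 3]? = some ((k : ℤ) + 2, 0, false) := by
      rw [show 2 * k + 3 = 2 * (k + 1) + 1 by ring, P' (by push_cast; omega)]; push_cast; ring_nf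
    have eq := Q (by omega)
    obtain ⟨t0, -, -⟩ := trav_even hc hnd hin hB hirr ((k : ℤ) + 2) (by rw [hhead]; omega) (by omega)
    have e := next_of_trav hnd t0 (m := 2 * k + 3) ep (fun m' hm' => by
      obtain rfl : m' = 2 * k + 2 := by omega
      rw [eq]; simp)
    rw [show 2 * (k + 1) + 2 = 2 * k + 3 + 1 by ring, e]; push_cast; ring_nf

/-- On rail 0 the middle coordinate is `0`: positions `1 ≤ i ≤ ξ_end − 1` (plumbing for the freshness arguments).
[cite: DuminilCopinHammond2013, §2.2; lane «pcv-sawmu» a-p2 g25] -/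
theorem caseA_rail0_b (hc : l.IsChain hvGraph.Adj) (hnd : l.Nodup) (hin : InLev 3 l) (hB : IsHBridge l)
    (hirr : ∀ i, ¬ IsRenewalIdx l i) (h0 : l[0]? = some (0, 0, true)) (h1 : l[1]? = some (1, 0, false))
    {i : ℕ} (hi : (i : ℤ) + 1 ≤ xi (l.getLast hB.1)) : ∃ v, l[i]? = some v ∧ v.2.1 = 0 ∧ xi v = i + 1 := by
  obtain ⟨k, rfl | rfl⟩ := Nat.even_or_odd' i
  · rcases k with _ | k
    · exact ⟨_, h0, rfl, by simp [xi, bit]⟩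
    · have := (caseA_rail0 hc hnd hin hB hirr h0 h1 k).2 (by push_cast at hi ⊢; omega)
      refine ⟨_, by rw [show 2 * (k + 1) = 2 * k + 2 by ring]; exact this, rfl, ?_⟩
      simp only [xi, bit_true]; push_cast; ring
  · have := (caseA_rail0 hc hnd hin hB hirr h0 h1 k).1 (by push_cast at hi ⊢; omega)
    exact ⟨_, this, rfl, by simp only [xi, bit_false]; push_cast; ring⟩

/-- Common hypotheses ⇒ the head column is `1` and a member `w ≠ (0,0,t)` has `1 < ξ(w) ≤ ξ_end`, `0 ≤ lev w ≤ 5` (plumbing).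
[cite: DuminilCopinHammond2013, §2.2; lane plumbing] -/
theorem caseA_mem (hin : InLev 3 l) (hB : IsHBridge l) (h0 : l[0]? = some (0, 0, true)) {w : HV} (hw : w ∈ l)
    (hne : w ≠ (0, 0, true)) :
    1 < 2 * w.1 + w.2.1 + bit w ∧ 2 * w.1 + w.2.1 + bit w ≤ xi (l.getLast hB.1) ∧ 0 ≤ 2 * w.2.1 + bit w ∧ 2 * w.2.1 + bit w ≤ 5 := by
  have hh := xi_head_of_at_zero hB.1 h0
  have hb := xi_bounds_of_mem hB hw (by rw [hh]; exact hne)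
  rw [hh] at hb
  have hl := hin w hw
  have e1 : xi ((0, 0, true) : HV) = 1 := by simp [xi]
  rw [e1] at hb
  simp only [xi, lev] at hb hl
  push_cast at hl
  exact ⟨hb.1, hb.2, hl.1, by omega⟩

/-- **The last column is odd.**  Under the case-A hypotheses with `ξ_end ≥ 3`, `ξ_end = 2K + 1` for some `K ≥ 1`: if `ξ_end = 2K'`
were even, rail 0 would end at the level-0 vertex `(K',0,f)` of the last column, a dead end, so the walk would stop there — before
traversing the rail-1 edge across the cut `2K' − ½`. [cite: DuminilCopinHammond2013, §2.2 (irreducible bridges); lane «pcv-sawmu» a-p2 g25 — own result] -/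
theorem caseA_odd (hc : l.IsChain hvGraph.Adj) (hnd : l.Nodup) (hin : InLev 3 l) (hB : IsHBridge l)
    (hirr : ∀ i, ¬ IsRenewalIdx l i) (h0 : l[0]? = some (0, 0, true)) (h1 : l[1]? = some (1, 0, false))
    (hE : 3 ≤ xi (l.getLast hB.1)) : ∃ K : ℕ, 1 ≤ K ∧ xi (l.getLast hB.1) = 2 * K + 1 := by
  have hhead : xi (l.head hB.1) = 1 := by rw [xi_head_of_at_zero hB.1 h0]; simp [xi, bit]
  obtain ⟨K', hK' | hK'⟩ := Int.even_or_odd' (xi (l.getLast hB.1))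
  · exfalso
    obtain ⟨K', rfl⟩ : ∃ n : ℕ, K' = (n : ℤ) + 2 := ⟨(K' - 2).toNat, by omega⟩
    -- rail 0 reaches `(K'+2, 0, f)` at position `2K'+3`, the last column
    have eK := (caseA_rail0 hc hnd hin hB hirr h0 h1 (K' + 1)).1 (by push_cast; omega)
    have hdead := dead_end hc hnd eK (by omega) ((K' : ℤ) + 1, 0, true) (fun w' hw' hadj => by
      rcases W2.adj_false_iff.1 hadj with rfl | rfl | rfl
      · have := (caseA_mem hin hB h0 hw' (by simp; omega)).2.1
        simp only [bit_true] at this; omega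
      · push_cast; ring_nf
      · have := (caseA_mem hin hB h0 hw' (by simp)).2.2.1
        simp only [bit_true] at this; omega)
    -- but the rail-1 edge across the cut `2K'+3 + ½` is traversed, by a vertex not among `l[0 .. 2K'+3]`
    obtain ⟨-, t1, -⟩ := trav_odd hc hnd hin hB hirr ((K' : ℤ) + 1) (by rw [hhead]; omega) (by omega)
    have hlen := length_gt_of_trav t1 (j := 2 * (K' + 1) + 1) (fun i hi => by
      obtain ⟨v, hv, hb, -⟩ := caseA_rail0_b hc hnd hin hB hirr h0 h1 (i := i) (by omega)
      rw [hv]; constructor <;> simp only [ne_eq, Option.some_inj] <;> rintro rfl <;> simp at hb)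
    omega
  · obtain ⟨K, rfl⟩ : ∃ n : ℕ, K' = (n : ℤ) + 1 := ⟨(K' - 1).toNat, by omega⟩
    exact ⟨K + 1, by omega, by push_cast at hK' ⊢; omega⟩

/-- **The first turn.**  With `ξ_end = 2K + 1`: `l[2K] = (K,0,t)` (end of rail 0) and `l[2K+1] = (K,1,f)` (the rung of the last column).
[cite: DuminilCopinHammond2013, §2.2 (irreducible bridges); lane «pcv-sawmu» a-p2 g25 — own result] -/
theorem caseA_turn1 (hc : l.IsChain hvGraph.Adj) (hnd : l.Nodup) (hin : InLev 3 l) (hB : IsHBridge l)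
    (hirr : ∀ i, ¬ IsRenewalIdx l i) (h0 : l[0]? = some (0, 0, true)) (h1 : l[1]? = some (1, 0, false))
    {K : ℕ} (hK : 1 ≤ K) (hE : xi (l.getLast hB.1) = 2 * K + 1) :
    l[2 * K]? = some ((K : ℤ), 0, true) ∧ l[2 * K + 1]? = some ((K : ℤ), 1, false) := by
  have hhead : xi (l.head hB.1) = 1 := by rw [xi_head_of_at_zero hB.1 h0]; simp [xi, bit]
  obtain ⟨K, rfl⟩ : ∃ n, K = n + 1 := ⟨K - 1, by omega⟩
  have eT := (caseA_rail0 hc hnd hin hB hirr h0 h1 K).2 (by push_cast at hE ⊢; omega)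
  have eF := (caseA_rail0 hc hnd hin hB hirr h0 h1 K).1 (by push_cast at hE ⊢; omega)
  rw [show 2 * (K + 1) = 2 * K + 2 by ring]
  refine ⟨by rw [eT]; push_cast; ring_nf, ?_⟩
  -- the walk goes on: the rail-1 edge across the cut `2K+2 + ½` is still to be traversed
  obtain ⟨-, t1, -⟩ := trav_even hc hnd hin hB hirr ((K : ℤ) + 1) (by rw [hhead]; omega) (by rw [hE]; push_cast; omega)
  have hlen := length_gt_of_trav t1 (j := 2 * K + 2) (fun i hi => by
    obtain ⟨v, hv, hb, -⟩ := caseA_rail0_b hc hnd hin hB hirr h0 h1 (i := i) (by rw [hE]; push_cast; omega)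
    rw [hv]; constructor <;> simp only [ne_eq, Option.some_inj] <;> rintro rfl <;> simp at hb)
  have := next_of_two hc hnd eT (by omega) (by omega) (z := ((K : ℤ) + 1, 0, false)) (z' := ((K : ℤ) + 1, 1, false))
    (fun w' hw' hadj => by
      rcases W2.adj_true_iff.1 hadj with rfl | rfl | rfl
      · exact Or.inl rfl
      · have := (caseA_mem hin hB h0 hw' (by simp)).2.1
        rw [hE] at this; simp only [bit_false] at this; omega
      · exact Or.inr rfl)
    (by rw [show 2 * K + 2 - 1 = 2 * K + 1 by omega, eF])
  rw [this]; push_cast; ring_nf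

/-- **Rail 1, leftward.**  With `ξ_end = 2K + 1`: `l[2K+1+2i] = (K−i,1,f)` and `l[2K+2+2i] = (K−i−1,1,t)` for `i ≤ K − 1` — after the
first turn the walk runs back along the middle rail down to column `2`. [cite: DuminilCopinHammond2013, §2.2 (irreducible bridges); lane «pcv-sawmu» a-p2 g25 — own result] -/
theorem caseA_rail1 (hc : l.IsChain hvGraph.Adj) (hnd : l.Nodup) (hin : InLev 3 l) (hB : IsHBridge l)
    (hirr : ∀ i, ¬ IsRenewalIdx l i) (h0 : l[0]? = some (0, 0, true)) (h1 : l[1]? = some (1, 0, false))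
    {K : ℕ} (hK : 1 ≤ K) (hE : xi (l.getLast hB.1) = 2 * K + 1) (i : ℕ) (hi : i + 1 ≤ K) :
    l[2 * K + 1 + 2 * i]? = some ((K : ℤ) - i, 1, false) ∧ l[2 * K + 2 + 2 * i]? = some ((K : ℤ) - i - 1, 1, true) := by
  have hhead : xi (l.head hB.1) = 1 := by rw [xi_head_of_at_zero hB.1 h0]; simp [xi, bit]
  obtain ⟨eT, eF⟩ := caseA_turn1 hc hnd hin hB hirr h0 h1 hK hE
  -- V(i) from U(i) and the value at the previous position
  have stepV : ∀ i : ℕ, i + 1 ≤ K → l[2 * K + 1 + 2 * i]? = some ((K : ℤ) - i, 1, false) →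
      l[2 * K + 2 * i]? ≠ some ((K : ℤ) - i - 1, 1, true) → l[2 * K + 2 + 2 * i]? = some ((K : ℤ) - i - 1, 1, true) := by
    intro i hi hU hprev
    obtain ⟨-, t1, -⟩ := trav_even hc hnd hin hB hirr ((K : ℤ) - i) (by rw [hhead]; omega) (by rw [hE]; omega)
    have := next_of_trav hnd t1.symm (m := 2 * K + 1 + 2 * i) hU (fun m' hm' => by
      obtain rfl : m' = 2 * K + 2 * i := by omega
      exact hprev)
    rw [show 2 * K + 2 + 2 * i = 2 * K + 1 + 2 * i + 1 by ring, this]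
  induction i with
  | zero =>
    have U : l[2 * K + 1 + 2 * 0]? = some ((K : ℤ) - (0 : ℕ), 1, false) := by simpa using eF
    refine ⟨U, stepV 0 hi U ?_⟩
    rw [show 2 * K + 2 * 0 = 2 * K by ring, eT]; simp
  | succ i ih =>
    obtain ⟨U, V⟩ := ih (by omega)
    -- U(i+1) from V(i): the rail-1 edge across the odd cut `2(K-i)-1 + ½`
    obtain ⟨-, t1, -⟩ := trav_odd hc hnd hin hB hirr ((K : ℤ) - i - 1) (by rw [hhead]; omega) (by rw [hE]; omega)
    have U' := next_of_trav hnd t1.symm (m := 2 * K + 2 + 2 * i) V (fun m' hm' => by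
      obtain rfl : m' = 2 * K + 1 + 2 * i := by omega
      rw [U]; simp; omega)
    have U'' : l[2 * K + 1 + 2 * (i + 1)]? = some ((K : ℤ) - (i + 1 : ℕ), 1, false) := by
      rw [show 2 * K + 1 + 2 * (i + 1) = 2 * K + 2 + 2 * i + 1 by ring, U']; push_cast; ring_nf
    refine ⟨U'', ?_⟩
    have := stepV (i + 1) hi U'' (by
      rw [show 2 * K + 2 * (i + 1) = 2 * K + 2 + 2 * i by ring, V]; simp)
    rw [this]

/-- Up to the end of rail 1 the walk stays on rails 0 and 1 (middle coordinate `≤ 1`; plumbing for freshness).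
[cite: DuminilCopinHammond2013, §2.2; lane «pcv-sawmu» a-p2 g25] -/
theorem caseA_rail01_b (hc : l.IsChain hvGraph.Adj) (hnd : l.Nodup) (hin : InLev 3 l) (hB : IsHBridge l)
    (hirr : ∀ i, ¬ IsRenewalIdx l i) (h0 : l[0]? = some (0, 0, true)) (h1 : l[1]? = some (1, 0, false))
    {K : ℕ} (hK : 1 ≤ K) (hE : xi (l.getLast hB.1) = 2 * K + 1) {i : ℕ} (hi : i ≤ 4 * K) :
    ∃ v, l[i]? = some v ∧ v.2.1 ≤ 1 := by
  rcases Nat.lt_or_ge i (2 * K + 1) with h | h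
  · obtain ⟨v, hv, hb, -⟩ := caseA_rail0_b hc hnd hin hB hirr h0 h1 (i := i) (by rw [hE]; omega)
    exact ⟨v, hv, by omega⟩
  · obtain ⟨j, hj⟩ : ∃ j, i = 2 * K + 1 + j := ⟨i - (2 * K + 1), by omega⟩
    obtain ⟨m, rfl | rfl⟩ := Nat.even_or_odd' j
    · obtain ⟨U, -⟩ := caseA_rail1 hc hnd hin hB hirr h0 h1 hK hE m (by omega)
      exact ⟨_, by rw [hj]; exact U, le_rfl⟩
    · obtain ⟨-, V⟩ := caseA_rail1 hc hnd hin hB hirr h0 h1 hK hE m (by omega)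
      exact ⟨_, by rw [hj, show 2 * K + 1 + (2 * m + 1) = 2 * K + 2 + 2 * m by ring]; exact V, le_rfl⟩

/-- **The second turn.**  `l[4K] = (0,1,t)` (end of rail 1, column 2) and `l[4K+1] = (0,2,f)` (the rung of column 2).
[cite: DuminilCopinHammond2013, §2.2 (irreducible bridges); lane «pcv-sawmu» a-p2 g25 — own result] -/
theorem caseA_turn2 (hc : l.IsChain hvGraph.Adj) (hnd : l.Nodup) (hin : InLev 3 l) (hB : IsHBridge l)
    (hirr : ∀ i, ¬ IsRenewalIdx l i) (h0 : l[0]? = some (0, 0, true)) (h1 : l[1]? = some (1, 0, false))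
    {K : ℕ} (hK : 1 ≤ K) (hE : xi (l.getLast hB.1) = 2 * K + 1) :
    l[4 * K]? = some (0, 1, true) ∧ l[4 * K + 1]? = some (0, 2, false) := by
  have hhead : xi (l.head hB.1) = 1 := by rw [xi_head_of_at_zero hB.1 h0]; simp [xi, bit]
  obtain ⟨K, rfl⟩ : ∃ n, K = n + 1 := ⟨K - 1, by omega⟩
  obtain ⟨U, V⟩ := caseA_rail1 hc hnd hin hB hirr h0 h1 hK hE K le_rfl
  have eV : l[4 * (K + 1)]? = some (0, 1, true) := by
    rw [show 4 * (K + 1) = 2 * (K + 1) + 2 + 2 * K by ring, V]; push_cast; ring_nf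
  have eU : l[4 * (K + 1) - 1]? = some (1, 1, false) := by
    rw [show 4 * (K + 1) - 1 = 2 * (K + 1) + 1 + 2 * K by omega, U]; push_cast; ring_nf
  refine ⟨eV, ?_⟩
  -- the walk goes on: the rail-2 edge across the cut `2 + ½` is still to be traversed
  obtain ⟨-, -, t2⟩ := trav_even hc hnd hin hB hirr 1 (by rw [hhead]; norm_num) (by rw [hE]; push_cast; omega)
  have hlen := length_gt_of_trav t2 (j := 4 * (K + 1)) (fun i hi => by
    obtain ⟨v, hv, hb⟩ := caseA_rail01_b hc hnd hin hB hirr h0 h1 hK hE (i := i) hi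
    rw [hv]; constructor <;> simp only [ne_eq, Option.some_inj] <;> rintro rfl <;> simp at hb)
  exact next_of_two hc hnd eV (by omega) (by omega) (z := (1, 1, false)) (z' := (0, 2, false))
    (fun w' hw' hadj => by
      rcases W2.adj_true_iff.1 hadj with rfl | rfl | rfl
      · have := (caseA_mem hin hB h0 hw' (by simp)).1
        simp only [bit_false] at this; omega
      · exact Or.inl (by norm_num)
      · exact Or.inr (by norm_num))
    eU

/-- **Rail 2, rightward.**  `l[4K+1+2i] = (i,2,f)` and `l[4K+2+2i] = (i,2,t)` for `i ≤ K − 1`: the walk runs along the top rail to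
the last column. [cite: DuminilCopinHammond2013, §2.2 (irreducible bridges); lane «pcv-sawmu» a-p2 g25 — own result] -/
theorem caseA_rail2 (hc : l.IsChain hvGraph.Adj) (hnd : l.Nodup) (hin : InLev 3 l) (hB : IsHBridge l)
    (hirr : ∀ i, ¬ IsRenewalIdx l i) (h0 : l[0]? = some (0, 0, true)) (h1 : l[1]? = some (1, 0, false))
    {K : ℕ} (hK : 1 ≤ K) (hE : xi (l.getLast hB.1) = 2 * K + 1) (i : ℕ) (hi : i + 1 ≤ K) :
    l[4 * K + 1 + 2 * i]? = some ((i : ℤ), 2, false) ∧ l[4 * K + 2 + 2 * i]? = some ((i : ℤ), 2, true) := by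
  have hhead : xi (l.head hB.1) = 1 := by rw [xi_head_of_at_zero hB.1 h0]; simp [xi, bit]
  obtain ⟨eV, eW⟩ := caseA_turn2 hc hnd hin hB hirr h0 h1 hK hE
  have stepX : ∀ i : ℕ, i + 1 ≤ K → l[4 * K + 1 + 2 * i]? = some ((i : ℤ), 2, false) →
      l[4 * K + 2 * i]? ≠ some ((i : ℤ), 2, true) → l[4 * K + 2 + 2 * i]? = some ((i : ℤ), 2, true) := by
    intro i hi hW hprev
    obtain ⟨-, -, t2⟩ := trav_even hc hnd hin hB hirr ((i : ℤ) + 1) (by rw [hhead]; omega) (by rw [hE]; omega)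
    have := next_of_trav hnd (by simpa using t2) (m := 4 * K + 1 + 2 * i) hW (fun m' hm' => by
      obtain rfl : m' = 4 * K + 2 * i := by omega
      exact hprev)
    rw [show 4 * K + 2 + 2 * i = 4 * K + 1 + 2 * i + 1 by ring, this]
  induction i with
  | zero =>
    have W : l[4 * K + 1 + 2 * 0]? = some (((0 : ℕ) : ℤ), 2, false) := by simpa using eW
    refine ⟨W, stepX 0 hi W ?_⟩
    rw [show 4 * K + 2 * 0 = 4 * K by ring, eV]; simp
  | succ i ih =>
    obtain ⟨W, X⟩ := ih (by omega)
    obtain ⟨-, -, t2⟩ := trav_odd hc hnd hin hB hirr ((i : ℤ) + 1) (by rw [hhead]; omega) (by rw [hE]; omega)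
    have W' := next_of_trav hnd (by simpa using t2) (m := 4 * K + 2 + 2 * i) X (fun m' hm' => by
      obtain rfl : m' = 4 * K + 1 + 2 * i := by omega
      rw [W]; simp)
    have W'' : l[4 * K + 1 + 2 * (i + 1)]? = some (((i + 1 : ℕ) : ℤ), 2, false) := by
      rw [show 4 * K + 1 + 2 * (i + 1) = 4 * K + 2 + 2 * i + 1 by ring, W']; push_cast; ring_nf
    refine ⟨W'', ?_⟩
    have := stepX (i + 1) hi W'' (by
      rw [show 4 * K + 2 * (i + 1) = 4 * K + 2 + 2 * i by ring, X]; simp)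
    rw [this]

/-- **The end.**  `l[6K] = (K−1,2,t)` is a dead end: the list has exactly `6K + 1` vertices.
[cite: DuminilCopinHammond2013, §2.2 (irreducible bridges); lane «pcv-sawmu» a-p2 g25 — own result] -/
theorem caseA_length (hc : l.IsChain hvGraph.Adj) (hnd : l.Nodup) (hin : InLev 3 l) (hB : IsHBridge l)
    (hirr : ∀ i, ¬ IsRenewalIdx l i) (h0 : l[0]? = some (0, 0, true)) (h1 : l[1]? = some (1, 0, false))
    {K : ℕ} (hK : 1 ≤ K) (hE : xi (l.getLast hB.1) = 2 * K + 1) : l.length = 6 * K + 1 := by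
  obtain ⟨K, rfl⟩ : ∃ n, K = n + 1 := ⟨K - 1, by omega⟩
  obtain ⟨-, X⟩ := caseA_rail2 hc hnd hin hB hirr h0 h1 hK hE K le_rfl
  have eX : l[6 * (K + 1)]? = some ((K : ℤ), 2, true) := by
    rw [show 6 * (K + 1) = 4 * (K + 1) + 2 + 2 * K by ring, X]
  have hdead := dead_end hc hnd eX (by omega) ((K : ℤ), 2, false) (fun w' hw' hadj => by
    rcases W2.adj_true_iff.1 hadj with rfl | rfl | rfl
    · rfl
    · have := (caseA_mem hin hB h0 hw' (by simp)).2.1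
      rw [hE] at this; simp only [bit_false] at this; omega
    · have := (caseA_mem hin hB h0 hw' (by simp)).2.2.2
      simp only [bit_false] at this; omega)
  omega

/-! ### §6 The upward serpentine `serpUp K` (`1 → 5`, `6K` steps, `K` top contacts) and the identification -/

/-- Rail-0 segment of the upward serpentine: `(1,0,f), (1,0,t), (2,0,f), …, (K,0,t)` (columns `2 … 2K+1`).
[cite: DuminilCopinHammond2013, §2.2 (irreducible bridges); lane «pcv-sawmu» a-p2 g25] -/
def rail0L (K : ℕ) : List HV :=
  (List.range (2 * K)).map fun j => if j % 2 = 0 then (((j / 2 : ℕ) : ℤ) + 1, 0, false) else (((j / 2 : ℕ) : ℤ) + 1, 0, true)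

/-- Rail-1 segment of the upward serpentine, run leftward: `(K,1,f), (K−1,1,t), (K−1,1,f), …, (0,1,t)` (columns `2K+1 … 2`).
[cite: DuminilCopinHammond2013, §2.2 (irreducible bridges); lane «pcv-sawmu» a-p2 g25] -/
def rail1L (K : ℕ) : List HV :=
  (List.range (2 * K)).map fun j => if j % 2 = 0 then ((K : ℤ) - (j / 2 : ℕ), 1, false) else ((K : ℤ) - (j / 2 : ℕ) - 1, 1, true)

/-- Rail-2 segment of the upward serpentine: `(0,2,f), (0,2,t), (1,2,f), …, (K−1,2,t)` (columns `2 … 2K+1`; the `K` odd columns are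
the top contacts). [cite: DuminilCopinHammond2013, §2.2 (irreducible bridges); lane «pcv-sawmu» a-p2 g25] -/
def rail2L (K : ℕ) : List HV :=
  (List.range (2 * K)).map fun j => if j % 2 = 0 then (((j / 2 : ℕ) : ℤ), 2, false) else (((j / 2 : ℕ) : ℤ), 2, true)

/-- ★ **The upward serpentine** `serpUp K` (`K ≥ 1`): from `(0,0,t)` (level 1, column 1) right along rail 0 to column `2K+1`, up the
rung, left along rail 1 to column 2, up the rung, right along rail 2 to `(K−1,2,t)` (level 5, column `2K+1`): `6K` steps, every
internal column crossed thrice. [cite: DuminilCopinHammond2013, §2.2 (irreducible bridges); lane «pcv-sawmu» a-p2 g25 — own object] -/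
def serpUp (K : ℕ) : List HV := (0, 0, true) :: (rail0L K ++ rail1L K ++ rail2L K)

/-- Lengths of the rail segments (plumbing). [cite: DuminilCopinHammond2013, §2.2; lane plumbing] -/
@[simp] theorem length_rails (K : ℕ) : (rail0L K).length = 2 * K ∧ (rail1L K).length = 2 * K ∧ (rail2L K).length = 2 * K := by
  simp [rail0L, rail1L, rail2L]

/-- `serpUp K` has `6K + 1` vertices. [cite: DuminilCopinHammond2013, §2.2; lane «pcv-sawmu» a-p2 g25] -/
@[simp] theorem length_serpUp (K : ℕ) : (serpUp K).length = 6 * K + 1 := by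
  simp [serpUp, rail0L, rail1L, rail2L]; ring

/-- Positions `1 … 2K` of `serpUp K` (rail 0). [cite: DuminilCopinHammond2013, §2.2; lane «pcv-sawmu» a-p2 g25] -/
theorem serpUp_rail0 (K : ℕ) {j : ℕ} (hj : j < 2 * K) :
    (serpUp K)[j + 1]? = some (if j % 2 = 0 then ((((j / 2 : ℕ) : ℤ) + 1, 0, false) : HV) else (((j / 2 : ℕ) : ℤ) + 1, 0, true)) := by
  rw [serpUp, List.getElem?_cons_succ, List.append_assoc, List.getElem?_append_left (by simp [rail0L]; exact hj), rail0L,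
    List.getElem?_map, List.getElem?_range hj]
  rfl

/-- Positions `2K+1 … 4K` of `serpUp K` (rail 1). [cite: DuminilCopinHammond2013, §2.2; lane «pcv-sawmu» a-p2 g25] -/
theorem serpUp_rail1 (K : ℕ) {j : ℕ} (hj : j < 2 * K) :
    (serpUp K)[2 * K + 1 + j]? =
      some (if j % 2 = 0 then (((K : ℤ) - (j / 2 : ℕ), 1, false) : HV) else ((K : ℤ) - (j / 2 : ℕ) - 1, 1, true)) := by
  rw [serpUp, show 2 * K + 1 + j = (2 * K + j) + 1 by ring, List.getElem?_cons_succ, List.append_assoc,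
    List.getElem?_append_right (by simp [rail0L]), (length_rails K).1, show 2 * K + j - 2 * K = j by omega,
    List.getElem?_append_left (by simp [rail1L]; exact hj), rail1L, List.getElem?_map, List.getElem?_range hj]
  rfl

/-- Positions `4K+1 … 6K` of `serpUp K` (rail 2). [cite: DuminilCopinHammond2013, §2.2; lane «pcv-sawmu» a-p2 g25] -/
theorem serpUp_rail2 (K : ℕ) {j : ℕ} (hj : j < 2 * K) :
    (serpUp K)[4 * K + 1 + j]? = some (if j % 2 = 0 then ((((j / 2 : ℕ) : ℤ), 2, false) : HV) else (((j / 2 : ℕ) : ℤ), 2, true)) := by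
  rw [serpUp, show 4 * K + 1 + j = (4 * K + j) + 1 by ring, List.getElem?_cons_succ, List.append_assoc,
    List.getElem?_append_right (by simp [rail0L]; omega), (length_rails K).1,
    List.getElem?_append_right (by simp [rail1L]; omega), (length_rails K).2.1, show 4 * K + j - 2 * K - 2 * K = j by omega,
    rail2L, List.getElem?_map, List.getElem?_range hj]
  rfl

/-- ★★ **Identification.**  An irreducible self-avoiding bridge of `S₃` starting `(0,0,t) → (1,0,f)` with last column
`ξ_end = 2K + 1` IS the serpentine `serpUp K`. [cite: DuminilCopinHammond2013, §2.2 (irreducible bridges); lane «pcv-sawmu» a-p2 g25 — own result] -/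
theorem caseA_eq_serpUp (hc : l.IsChain hvGraph.Adj) (hnd : l.Nodup) (hin : InLev 3 l) (hB : IsHBridge l)
    (hirr : ∀ i, ¬ IsRenewalIdx l i) (h0 : l[0]? = some (0, 0, true)) (h1 : l[1]? = some (1, 0, false))
    {K : ℕ} (hK : 1 ≤ K) (hE : xi (l.getLast hB.1) = 2 * K + 1) : l = serpUp K := by
  have hlen := caseA_length hc hnd hin hB hirr h0 h1 hK hE
  apply List.ext_getElem?
  intro i
  rcases Nat.lt_or_ge i (6 * K + 1) with hi | hi
  swap
  · rw [List.getElem?_eq_none (by omega), List.getElem?_eq_none (by simp; omega)]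
  rcases Nat.eq_zero_or_pos i with rfl | hi0
  · rw [h0]; rfl
  rcases Nat.lt_or_ge i (2 * K + 1) with hA | hA
  · -- rail 0: i = j + 1
    obtain ⟨j, rfl⟩ : ∃ j, i = j + 1 := ⟨i - 1, by omega⟩
    rw [serpUp_rail0 K (by omega)]
    obtain ⟨k, rfl | rfl⟩ := Nat.even_or_odd' j
    · rw [(caseA_rail0 hc hnd hin hB hirr h0 h1 k).1 (by rw [hE]; omega), if_pos (by omega),
        show 2 * k / 2 = k by omega]
    · rw [show 2 * k + 1 + 1 = 2 * k + 2 by ring, (caseA_rail0 hc hnd hin hB hirr h0 h1 k).2 (by rw [hE]; omega),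
        if_neg (by omega), show (2 * k + 1) / 2 = k by omega]
  rcases Nat.lt_or_ge i (4 * K + 1) with hB' | hB'
  · -- rail 1: i = 2K+1+j
    obtain ⟨j, rfl⟩ : ∃ j, i = 2 * K + 1 + j := ⟨i - (2 * K + 1), by omega⟩
    rw [serpUp_rail1 K (by omega)]
    obtain ⟨m, rfl | rfl⟩ := Nat.even_or_odd' j
    · rw [(caseA_rail1 hc hnd hin hB hirr h0 h1 hK hE m (by omega)).1, if_pos (by omega), show 2 * m / 2 = m by omega]
    · rw [show 2 * K + 1 + (2 * m + 1) = 2 * K + 2 + 2 * m by ring, (caseA_rail1 hc hnd hin hB hirr h0 h1 hK hE m (by omega)).2,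
        if_neg (by omega), show (2 * m + 1) / 2 = m by omega]
  · -- rail 2: i = 4K+1+j
    obtain ⟨j, rfl⟩ : ∃ j, i = 4 * K + 1 + j := ⟨i - (4 * K + 1), by omega⟩
    rw [serpUp_rail2 K (by omega)]
    obtain ⟨m, rfl | rfl⟩ := Nat.even_or_odd' j
    · rw [(caseA_rail2 hc hnd hin hB hirr h0 h1 hK hE m (by omega)).1, if_pos (by omega), show 2 * m / 2 = m by omega]
    · rw [show 4 * K + 1 + (2 * m + 1) = 4 * K + 2 + 2 * m by ring, (caseA_rail2 hc hnd hin hB hirr h0 h1 hK hE m (by omega)).2,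
        if_neg (by omega), show (2 * m + 1) / 2 = m by omega]

/-! ### §7 `serpUp K` is an irreducible standard bridge of `S₃` from level 1 to level 5 with `K` top contacts -/

/-- Positions of `serpUp K`, parity resolved (plumbing). [cite: DuminilCopinHammond2013, §2.2; lane «pcv-sawmu» a-p2 g25] -/
theorem serpUp_at (K m : ℕ) :
    ((serpUp K)[0]? = some (0, 0, true)) ∧
    (2 * m < 2 * K → (serpUp K)[2 * m + 1]? = some (((m : ℤ) + 1, 0, false) : HV)) ∧
    (2 * m + 1 < 2 * K → (serpUp K)[2 * m + 2]? = some (((m : ℤ) + 1, 0, true) : HV)) ∧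
    (2 * m < 2 * K → (serpUp K)[2 * K + 1 + 2 * m]? = some (((K : ℤ) - m, 1, false) : HV)) ∧
    (2 * m + 1 < 2 * K → (serpUp K)[2 * K + 2 + 2 * m]? = some (((K : ℤ) - m - 1, 1, true) : HV)) ∧
    (2 * m < 2 * K → (serpUp K)[4 * K + 1 + 2 * m]? = some (((m : ℤ), 2, false) : HV)) ∧
    (2 * m + 1 < 2 * K → (serpUp K)[4 * K + 2 + 2 * m]? = some (((m : ℤ), 2, true) : HV)) := by
  refine ⟨rfl, fun h => ?_, fun h => ?_, fun h => ?_, fun h => ?_, fun h => ?_, fun h => ?_⟩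
  · rw [serpUp_rail0 K h, if_pos (by omega), show 2 * m / 2 = m by omega]
  · rw [show 2 * m + 2 = (2 * m + 1) + 1 by ring, serpUp_rail0 K h, if_neg (by omega), show (2 * m + 1) / 2 = m by omega]
  · rw [serpUp_rail1 K h, if_pos (by omega), show 2 * m / 2 = m by omega]
  · rw [show 2 * K + 2 + 2 * m = 2 * K + 1 + (2 * m + 1) by ring, serpUp_rail1 K h, if_neg (by omega),
      show (2 * m + 1) / 2 = m by omega]
  · rw [serpUp_rail2 K h, if_pos (by omega), show 2 * m / 2 = m by omega]
  · rw [show 4 * K + 2 + 2 * m = 4 * K + 1 + (2 * m + 1) by ring, serpUp_rail2 K h, if_neg (by omega),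
      show (2 * m + 1) / 2 = m by omega]

/-- Every position of `serpUp K` resolved: column, level and rail as functions of the position (plumbing for the structural
properties). [cite: DuminilCopinHammond2013, §2.2; lane «pcv-sawmu» a-p2 g25] -/
theorem serpUp_pos (K : ℕ) {i : ℕ} (hi : i < 6 * K + 1) :
    ∃ v : HV, (serpUp K)[i]? = some v ∧ 0 ≤ lev v ∧ lev v ≤ 5 ∧
      ((i ≤ 2 * K ∧ xi v = i + 1 ∧ v.2.1 = 0) ∨ (2 * K + 1 ≤ i ∧ i ≤ 4 * K ∧ xi v = 4 * K + 2 - i ∧ v.2.1 = 1) ∨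
        (4 * K + 1 ≤ i ∧ xi v = i + 1 - 4 * K ∧ v.2.1 = 2 ∧ (lev v = 5 ↔ i % 2 = 0))) := by
  rcases Nat.eq_zero_or_pos i with rfl | hi0
  · exact ⟨_, (serpUp_at K 0).1, by simp [bit], by simp [bit], Or.inl ⟨by omega, by simp [xi, bit], rfl⟩⟩
  rcases Nat.lt_or_ge i (2 * K + 1) with hA | hA
  · obtain ⟨j, rfl⟩ : ∃ j, i = j + 1 := ⟨i - 1, by omega⟩
    obtain ⟨m, rfl | rfl⟩ := Nat.even_or_odd' j
    · refine ⟨_, (serpUp_at K m).2.1 (by omega), by simp [bit], by simp [bit], Or.inl ⟨by omega, ?_, rfl⟩⟩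
      simp [xi, bit]; ring
    · refine ⟨_, by rw [show 2 * m + 1 + 1 = 2 * m + 2 by ring]; exact (serpUp_at K m).2.2.1 (by omega), by simp [bit],
        by simp [bit], Or.inl ⟨by omega, ?_, rfl⟩⟩
      simp [xi, bit]; ring
  rcases Nat.lt_or_ge i (4 * K + 1) with hB | hB
  · obtain ⟨j, rfl⟩ : ∃ j, i = 2 * K + 1 + j := ⟨i - (2 * K + 1), by omega⟩
    obtain ⟨m, rfl | rfl⟩ := Nat.even_or_odd' j
    · refine ⟨_, (serpUp_at K m).2.2.2.1 (by omega), by simp [bit], by simp [bit], Or.inr (Or.inl ⟨by omega, by omega, ?_, rfl⟩)⟩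
      simp [xi, bit]; ring
    · refine ⟨_, by rw [show 2 * K + 1 + (2 * m + 1) = 2 * K + 2 + 2 * m by ring]; exact (serpUp_at K m).2.2.2.2.1 (by omega),
        by simp [bit], by simp [bit], Or.inr (Or.inl ⟨by omega, by omega, ?_, rfl⟩)⟩
      simp [xi, bit]; ring
  · obtain ⟨j, rfl⟩ : ∃ j, i = 4 * K + 1 + j := ⟨i - (4 * K + 1), by omega⟩
    obtain ⟨m, rfl | rfl⟩ := Nat.even_or_odd' j
    · refine ⟨_, (serpUp_at K m).2.2.2.2.2.1 (by omega), by simp [bit], by simp [bit],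
        Or.inr (Or.inr ⟨by omega, ?_, rfl, ?_⟩)⟩
      · simp [xi, bit]; ring
      · simp [bit]; omega
    · refine ⟨_, by rw [show 4 * K + 1 + (2 * m + 1) = 4 * K + 2 + 2 * m by ring]; exact (serpUp_at K m).2.2.2.2.2.2 (by omega),
        by simp [bit], by simp [bit], Or.inr (Or.inr ⟨by omega, ?_, rfl, ?_⟩)⟩
      · simp [xi, bit]; ring
      · simp [bit]; omega

/-- `getElem` from `getElem?` (plumbing). [folklore] -/
private theorem getElem_of_at {L : List HV} {i : ℕ} {v : HV} (h : L[i]? = some v) (hi : i < L.length) : L[i] = v :=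
  Option.some_inj.1 ((List.getElem?_eq_getElem hi).symm.trans h)

/-- `xiAt` from `getElem?` (plumbing). [folklore] -/
private theorem xiAt_of_at {L : List HV} {i : ℕ} {v : HV} (h : L[i]? = some v) : xiAt L i = xi v := by
  rw [xiAt, List.getD_eq_getElem?_getD, h, Option.getD_some]

/-- `serpUp K` is a nearest-neighbour path of `ℍ`. [cite: DuminilCopinHammond2013, §2.2; lane «pcv-sawmu» a-p2 g25] -/
theorem serpUp_isChain (K : ℕ) : (serpUp K).IsChain hvGraph.Adj := by
  refine List.isChain_iff_getElem.2 fun i hi => ?_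
  rw [length_serpUp] at hi
  have A := serpUp_at K
  -- produce the two explicit vertices and check adjacency
  have key : ∀ {u v : HV}, (serpUp K)[i]? = some u → (serpUp K)[i + 1]? = some v → hvGraph.Adj u v →
      hvGraph.Adj (serpUp K)[i] (serpUp K)[i + 1] := fun hu hv h => by
    rwa [getElem_of_at hu, getElem_of_at hv]
  rcases Nat.eq_zero_or_pos i with rfl | hi0
  · exact key (A 0).1 ((A 0).2.1 (by omega)) (by simp [hvGraph_adj, AdjRel])
  rcases Nat.lt_or_ge i (2 * K) with hR | hR
  · obtain ⟨j, rfl⟩ : ∃ j, i = j + 1 := ⟨i - 1, by omega⟩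
    obtain ⟨m, rfl | rfl⟩ := Nat.even_or_odd' j
    · exact key ((A m).2.1 (by omega)) ((A m).2.2.1 (by omega)) (by simp [hvGraph_adj, AdjRel])
    · exact key (by rw [show 2 * m + 1 + 1 = 2 * m + 2 by ring]; exact (A m).2.2.1 (by omega))
        (by rw [show 2 * m + 1 + 1 + 1 = 2 * (m + 1) + 1 by ring]; exact (A (m + 1)).2.1 (by omega))
        (by simp [hvGraph_adj, AdjRel])
  rcases hR.eq_or_lt with rfl | hR
  · -- first turn: `(K,0,t) – (K,1,f)`
    obtain ⟨K, rfl⟩ : ∃ n, K = n + 1 := ⟨K - 1, by omega⟩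
    exact key (by rw [show 2 * (K + 1) = 2 * K + 2 by ring]; exact (A K).2.2.1 (by omega))
      (by have := (A 0).2.2.2.1 (by omega); simpa using this) (by simp [hvGraph_adj, AdjRel])
  rcases Nat.lt_or_ge i (4 * K) with hR1 | hR1
  · obtain ⟨j, rfl⟩ : ∃ j, i = 2 * K + 1 + j := ⟨i - (2 * K + 1), by omega⟩
    obtain ⟨m, rfl | rfl⟩ := Nat.even_or_odd' j
    · have hv := (A m).2.2.2.2.1 (by omega)
      rw [show 2 * K + 2 + 2 * m = 2 * K + 1 + 2 * m + 1 by ring] at hv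
      exact key ((A m).2.2.2.1 (by omega)) hv (by simp [hvGraph_adj, AdjRel])
    · exact key (by rw [show 2 * K + 1 + (2 * m + 1) = 2 * K + 2 + 2 * m by ring]; exact (A m).2.2.2.2.1 (by omega))
        (by rw [show 2 * K + 1 + (2 * m + 1) + 1 = 2 * K + 1 + 2 * (m + 1) by ring]; exact (A (m + 1)).2.2.2.1 (by omega))
        (by simp [hvGraph_adj, AdjRel]; ring)
  rcases hR1.eq_or_lt with rfl | hR1
  · -- second turn: `(0,1,t) – (0,2,f)`
    obtain ⟨K, rfl⟩ : ∃ n, K = n + 1 := ⟨K - 1, by omega⟩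
    exact key (by rw [show 4 * (K + 1) = 2 * (K + 1) + 2 + 2 * K by ring]; exact (A K).2.2.2.2.1 (by omega))
      (by have := (A 0).2.2.2.2.2.1 (by omega); simpa using this) (by simp [hvGraph_adj, AdjRel])
  · obtain ⟨j, rfl⟩ : ∃ j, i = 4 * K + 1 + j := ⟨i - (4 * K + 1), by omega⟩
    obtain ⟨m, rfl | rfl⟩ := Nat.even_or_odd' j
    · have hv := (A m).2.2.2.2.2.2 (by omega)
      rw [show 4 * K + 2 + 2 * m = 4 * K + 1 + 2 * m + 1 by ring] at hv
      exact key ((A m).2.2.2.2.2.1 (by omega)) hv (by simp [hvGraph_adj, AdjRel])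
    · exact key (by rw [show 4 * K + 1 + (2 * m + 1) = 4 * K + 2 + 2 * m by ring]; exact (A m).2.2.2.2.2.2 (by omega))
        (by rw [show 4 * K + 1 + (2 * m + 1) + 1 = 4 * K + 1 + 2 * (m + 1) by ring]; exact (A (m + 1)).2.2.2.2.2.1 (by omega))
        (by simp [hvGraph_adj, AdjRel])

/-- `serpUp K` is self-avoiding (the rail and the column determine the position). [cite: DuminilCopinHammond2013, §2.2; lane «pcv-sawmu» a-p2 g25] -/
theorem serpUp_nodup (K : ℕ) : (serpUp K).Nodup := by
  rw [List.nodup_iff_injective_get]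
  rintro ⟨i, hi⟩ ⟨j, hj⟩ hij
  simp only [length_serpUp] at hi hj
  simp only [List.get_eq_getElem, Fin.mk.injEq] at hij ⊢
  obtain ⟨u, hu, -, -, Hu⟩ := serpUp_pos K hi
  obtain ⟨v, hv, -, -, Hv⟩ := serpUp_pos K hj
  have huv : u = v := by rw [← getElem_of_at hu (by simp; omega), ← getElem_of_at hv (by simp; omega), hij]
  subst huv
  rcases Hu with ⟨h1, h2, h3⟩ | ⟨h1, h2, h3, h4⟩ | ⟨h1, h2, h3, -⟩ <;>
    rcases Hv with ⟨g1, g2, g3⟩ | ⟨g1, g2, g3, g4⟩ | ⟨g1, g2, g3, -⟩ <;> omega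

/-- `serpUp K` lies in the strip `S₃`. [cite: DuminilCopinSmirnov2012, §3 (the strip S_T); lane «pcv-sawmu» a-p2 g25] -/
theorem serpUp_inLev (K : ℕ) : InLev 3 (serpUp K) := by
  intro v hv
  obtain ⟨i, hi, rfl⟩ := List.getElem_of_mem hv
  rw [length_serpUp] at hi
  obtain ⟨u, hu, h0, h5, -⟩ := serpUp_pos K hi
  rw [getElem_of_at hu]
  exact ⟨h0, by push_cast; omega⟩

/-- The last vertex of `serpUp K` (`K ≥ 1`) is `(K−1, 2, t)` (level 5, column `2K+1`). [cite: DuminilCopinHammond2013, §2.2; lane «pcv-sawmu» a-p2 g25] -/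
theorem serpUp_getLast {K : ℕ} (hK : 1 ≤ K) (h : serpUp K ≠ []) : (serpUp K).getLast h = ((K : ℤ) - 1, 2, true) := by
  obtain ⟨K, rfl⟩ : ∃ n, K = n + 1 := ⟨K - 1, by omega⟩
  rw [List.getLast_eq_getElem]
  have := (serpUp_at (K + 1) K).2.2.2.2.2.2 (by omega)
  rw [show 4 * (K + 1) + 2 + 2 * K = (serpUp (K + 1)).length - 1 by simp; omega] at this
  rw [getElem_of_at this]; push_cast; ring_nf

/-- `serpUp K` (`K ≥ 1`) is a horizontal bridge: head column `1`, all later columns in `[2, 2K+1]`, last column `2K+1`.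
[cite: DuminilCopinHammond2013, §2.2 (bridges); lane «pcv-sawmu» a-p2 g25] -/
theorem serpUp_isHBridge {K : ℕ} (hK : 1 ≤ K) : IsHBridge (serpUp K) := by
  refine ⟨by simp [serpUp], fun v hv => ?_⟩
  rw [serpUp_getLast hK, show (serpUp K).head (by simp [serpUp]) = (0, 0, true) by rfl]
  have hv' : v ∈ serpUp K := List.mem_of_mem_tail hv
  obtain ⟨i, hi, rfl⟩ := List.getElem_of_mem hv'
  rw [length_serpUp] at hi
  -- `i ≠ 0`: the head `(0,0,t)` does not occur in the tail (nodup)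
  have hi0 : i ≠ 0 := by
    rintro rfl
    have hnd := serpUp_nodup K
    unfold serpUp at hnd hv
    simp only [List.tail_cons, List.getElem_cons_zero] at hv
    exact (List.nodup_cons.1 hnd).1 hv
  obtain ⟨u, hu, -, -, H⟩ := serpUp_pos K hi
  rw [getElem_of_at hu]
  have e1 : xi ((0, 0, true) : HV) = 1 := by simp [xi]
  have e2 : xi (((K : ℤ) - 1, 2, true) : HV) = 2 * K + 1 := by simp [xi]; ring
  rw [e1, e2]
  rcases H with ⟨h1, h2, -⟩ | ⟨h1, h2, h3, -⟩ | ⟨h1, h2, -, -⟩ <;> omega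

/-- `serpUp K` (`K ≥ 1`) has NO renewal index (it is irreducible): every column `2 … 2K+1` is visited on all three rails.
[cite: DuminilCopinHammond2013, §2.2 (irreducible bridges); lane «pcv-sawmu» a-p2 g25 — own result] -/
theorem serpUp_not_isRenewalIdx {K : ℕ} (hK : 1 ≤ K) (i : ℕ) : ¬ IsRenewalIdx (serpUp K) i := by
  rintro ⟨hi0, hi1, hle, hlt⟩
  rw [length_serpUp] at hi1 hlt
  obtain ⟨u, hu, -, -, Hu⟩ := serpUp_pos K (i := i) (by omega)
  rw [xiAt_of_at hu] at hle hlt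
  rcases Hu with ⟨h1, h2, -⟩ | ⟨h1, h2, h3, -⟩ | ⟨h1, h2, -, -⟩
  · -- rail 0 at column `i+1`: rail 1 visits the same column later, at position `4K+1-i`
    obtain ⟨v, hv, -, -, Hv⟩ := serpUp_pos K (i := 4 * K + 1 - i) (by omega)
    have := hlt (4 * K + 1 - i) (mem_range.2 (by omega)) (by omega)
    rw [xiAt_of_at hv] at this
    rcases Hv with ⟨g1, g2, -⟩ | ⟨g1, g2, g3, -⟩ | ⟨g1, g2, -, -⟩ <;> omega
  · -- rail 1 at column `4K+2-i`: rail 2 visits it later, at position `8K+1-i`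
    obtain ⟨v, hv, -, -, Hv⟩ := serpUp_pos K (i := 8 * K + 1 - i) (by omega)
    have := hlt (8 * K + 1 - i) (mem_range.2 (by omega)) (by omega)
    rw [xiAt_of_at hv] at this
    rcases Hv with ⟨g1, g2, -⟩ | ⟨g1, g2, g3, -⟩ | ⟨g1, g2, -, -⟩ <;> omega
  · -- rail 2 at column `i+1-4K ≤ 2K`: rail 0 already visited column `2K+1` at position `2K`
    obtain ⟨v, hv, -, -, Hv⟩ := serpUp_pos K (i := 2 * K) (by omega)
    have := hle (2 * K) (mem_range.2 (by omega))
    rw [xiAt_of_at hv] at this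
    rcases Hv with ⟨g1, g2, -⟩ | ⟨g1, g2, g3, -⟩ | ⟨g1, g2, -, -⟩ <;> omega

/-- `serpUp K` has exactly `K` top contacts after its head (the odd columns of rail 2). [cite: BeatonBousquetMelouDeGierDuminilCopinGuttmann2014, §3.2 (surface visits weighted by y); lane «pcv-sawmu» a-p2 g25] -/
theorem topCnt_serpUp_tail (K : ℕ) : topCnt 3 (serpUp K).tail = K := by
  have h0 : ((rail0L K).filter fun v => lev v = 2 * (3 : ℕ) - 1) = [] := by
    rw [List.filter_eq_nil_iff]
    intro v hv
    obtain ⟨j, -, rfl⟩ := List.mem_map.1 hv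
    split_ifs <;> simp [bit]
  have h1 : ((rail1L K).filter fun v => lev v = 2 * (3 : ℕ) - 1) = [] := by
    rw [List.filter_eq_nil_iff]
    intro v hv
    obtain ⟨j, -, rfl⟩ := List.mem_map.1 hv
    split_ifs <;> simp [bit]
  have h2 : ∀ K : ℕ, ((rail2L K).filter fun v => lev v = 2 * (3 : ℕ) - 1).length = K := by
    intro K
    induction K with
    | zero => simp [rail2L]
    | succ K ih =>
      rw [rail2L, show 2 * (K + 1) = 2 * K + 1 + 1 by ring, List.range_succ, List.range_succ, List.map_append, List.map_append,
        List.filter_append, List.filter_append, List.length_append, List.length_append, ← rail2L, ih]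
      simp [bit, show (2 * K) % 2 = 0 by omega, show (2 * K + 1) % 2 = 1 by omega]
  rw [topCnt, serpUp, List.tail_cons, List.filter_append, List.filter_append, h0, h1, List.length_append, List.length_append, h2]
  simp

/-- The renewal weight of `serpUp K`: `x_c^{6K} y^K`. [cite: BeatonBousquetMelouDeGierDuminilCopinGuttmann2014, §4 (weights x^{|γ|} y^{contacts}); lane «pcv-sawmu» a-p2 g25] -/
theorem wD_serpUp (K : ℕ) (y : ℝ) : wD 3 y (serpUp K) = hexCriticalFugacity ^ (6 * K) * y ^ K := by
  rw [wD, topCnt_serpUp_tail, length_serpUp]; rfl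

/-- ★★ `serpUp K` (`K ≥ 1`, `6K ≤ N`) is a member of the irreducible class `HBk 3 N 1 1 5` (one piece, level 1 → level 5).
[cite: DuminilCopinHammond2013, §2.2 (irreducible bridges); lane «pcv-sawmu» a-p2 g25 — own result] -/
theorem serpUp_mem_HBk {K N : ℕ} (hK : 1 ≤ K) (hN : 6 * K ≤ N) : serpUp K ∈ HBk 3 N 1 1 5 := by
  rw [HBk, mem_filter, mem_hBridgesN_iff]
  refine ⟨⟨serpUp_isChain K, serpUp_nodup K, by simp; omega, ⟨(0, 0, true), rfl, rfl⟩, serpUp_inLev K, serpUp_isHBridge hK⟩,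
    by simp; omega, ?_, by simp [hdLev, serpUp], ?_⟩
  · rw [npieces, Nat.add_eq_right, Finset.card_eq_zero, renIdxs, Finset.filter_eq_empty_iff]
    exact fun i _ => serpUp_not_isRenewalIdx hK i
  · rw [ltLev, List.getLast?_eq_some_getLast (by simp [serpUp]), Option.getD_some, serpUp_getLast hK]
    simp [bit]

/-! ### §8 The half-turn symmetry of `S₃` (levels `L ↦ 5 − L`), the downward serpentine, and case B by transport -/

/-- The half-turn of `S₃` followed by a unit shift of the column: `(a,b,c) ↦ (a+b+bit−1, 2−b, ¬c)`; it maps `ℍ` onto itself,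
levels `L ↦ 5 − L` and columns `ξ ↦ ξ + 1`. [cite: DuminilCopinSmirnov2012, §3 (Fig. 3: the strip S_T is symmetric); lane «pcv-sawmu» a-p2 g25] -/
def flipA (v : HV) : HV := (v.1 + v.2.1 + bit v - 1, 2 - v.2.1, !v.2.2)

/-- The inverse half-turn: `(a,b,c) ↦ (a+b+bit−2, 2−b, ¬c)`; levels `L ↦ 5 − L`, columns `ξ ↦ ξ − 1`.
[cite: DuminilCopinSmirnov2012, §3 (Fig. 3: the strip S_T is symmetric); lane «pcv-sawmu» a-p2 g25] -/
def flipB (v : HV) : HV := (v.1 + v.2.1 + bit v - 2, 2 - v.2.1, !v.2.2)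

/-- `flipA ∘ flipB = id`. [cite: DuminilCopinSmirnov2012, §3; lane plumbing] -/
@[simp] theorem flipA_flipB (v : HV) : flipA (flipB v) = v := by
  obtain ⟨a, b, c⟩ := v
  cases c <;> simp [flipA, flipB, bit]
  all_goals omega

/-- `flipB ∘ flipA = id`. [cite: DuminilCopinSmirnov2012, §3; lane plumbing] -/
@[simp] theorem flipB_flipA (v : HV) : flipB (flipA v) = v := by
  obtain ⟨a, b, c⟩ := v
  cases c <;> simp [flipA, flipB, bit]
  all_goals omega

/-- Levels under the half-turns: `L ↦ 5 − L`. [cite: DuminilCopinSmirnov2012, §3; lane plumbing] -/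
@[simp] theorem lev_flipA (v : HV) : lev (flipA v) = 5 - lev v := by
  obtain ⟨a, b, c⟩ := v; cases c <;> simp [flipA, bit] <;> ring

/-- Levels under the half-turns: `L ↦ 5 − L`. [cite: DuminilCopinSmirnov2012, §3; lane plumbing] -/
@[simp] theorem lev_flipB (v : HV) : lev (flipB v) = 5 - lev v := by
  obtain ⟨a, b, c⟩ := v; cases c <;> simp [flipB, bit] <;> ring

/-- Columns under `flipA`: `ξ ↦ ξ + 1`. [cite: DuminilCopinSmirnov2012, §3; lane plumbing] -/
@[simp] theorem xi_flipA (v : HV) : xi (flipA v) = xi v + 1 := by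
  obtain ⟨a, b, c⟩ := v; cases c <;> simp [flipA, xi, bit] <;> ring

/-- Columns under `flipB`: `ξ ↦ ξ − 1`. [cite: DuminilCopinSmirnov2012, §3; lane plumbing] -/
@[simp] theorem xi_flipB (v : HV) : xi (flipB v) = xi v - 1 := by
  obtain ⟨a, b, c⟩ := v; cases c <;> simp [flipB, xi, bit] <;> ring

/-- `flipA` preserves adjacency. [cite: DuminilCopinSmirnov2012, §3; lane plumbing] -/
theorem adj_flipA {u v : HV} (h : hvGraph.Adj u v) : hvGraph.Adj (flipA u) (flipA v) := by
  obtain ⟨a, b, c⟩ := u; obtain ⟨a', b', c'⟩ := v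
  cases c <;> cases c' <;> simp [hvGraph_adj, AdjRel, flipA, bit] at h ⊢ <;> omega

/-- `flipB` preserves adjacency. [cite: DuminilCopinSmirnov2012, §3; lane plumbing] -/
theorem adj_flipB {u v : HV} (h : hvGraph.Adj u v) : hvGraph.Adj (flipB u) (flipB v) := by
  obtain ⟨a, b, c⟩ := u; obtain ⟨a', b', c'⟩ := v
  cases c <;> cases c' <;> simp [hvGraph_adj, AdjRel, flipB, bit] at h ⊢ <;> omega

/-- **Transport of the bridge structure** under a map of `S₃` that preserves adjacency, has a left inverse, flips the levels and
shifts the columns by a constant: chain, self-avoidance, `InLev 3`, the bridge property, the renewal indices and hence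
irreducibility all transfer. [cite: DuminilCopinHammond2013, §2.2 (bridges, renewal points); DuminilCopinSmirnov2012, §3; lane «pcv-sawmu» a-p2 g25] -/
theorem transport {σ τ : HV → HV} (hadj : ∀ u v, hvGraph.Adj u v → hvGraph.Adj (σ u) (σ v)) (hinv : ∀ v, τ (σ v) = v)
    (hlev : ∀ v, lev (σ v) = 5 - lev v) (d : ℤ) (hxi : ∀ v, xi (σ v) = xi v + d) {l : List HV}
    (hc : l.IsChain hvGraph.Adj) (hnd : l.Nodup) (hin : InLev 3 l) (hB : IsHBridge l) (hirr : ∀ i, ¬ IsRenewalIdx l i) :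
    (l.map σ).IsChain hvGraph.Adj ∧ (l.map σ).Nodup ∧ InLev 3 (l.map σ) ∧ IsHBridge (l.map σ) ∧
      (∀ i, ¬ IsRenewalIdx (l.map σ) i) := by
  have hinj : Function.Injective σ := Function.LeftInverse.injective hinv
  have hxiAt : ∀ j, j < l.length → xiAt (l.map σ) j = xiAt l j + d := fun j hj => by
    rw [xiAt, xiAt, List.getD_eq_getElem?_getD, List.getD_eq_getElem?_getD, List.getElem?_map, List.getElem?_eq_getElem hj]
    simp [hxi]
  refine ⟨(List.isChain_map σ).2 (hc.imp fun a b h => hadj a b h), hnd.map hinj, fun v hv => ?_, ?_, fun i hi => ?_⟩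
  · obtain ⟨w, hw, rfl⟩ := List.mem_map.1 hv
    have := hin w hw
    rw [hlev]; constructor <;> push_cast at this ⊢ <;> omega
  · obtain ⟨hne, hbr⟩ := hB
    refine ⟨by simpa using hne, fun v hv => ?_⟩
    rw [← List.map_tail] at hv
    obtain ⟨w, hw, rfl⟩ := List.mem_map.1 hv
    have := hbr w hw
    rw [List.head_map, List.getLast_map, hxi, hxi, hxi]
    omega
  · obtain ⟨hi0, hi1, hle, hlt⟩ := hi
    rw [List.length_map] at hi1 hlt
    refine hirr i ⟨hi0, hi1, fun j hj => ?_, fun j hj hij => ?_⟩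
    · have := hle j hj
      rw [mem_range] at hj
      rw [hxiAt j (by omega), hxiAt i (by omega)] at this
      omega
    · have := hlt j hj hij
      rw [mem_range] at hj
      rw [hxiAt j hj, hxiAt i (by omega)] at this
      omega

/-- ★ **The downward serpentine** `serpDn K := flipA (serpUp K)`: from `(0,2,f)` (level 4, column 2) right along rail 2, down, left
along rail 1, down, right along rail 0 to `(K+1,0,f)` (level 0, column `2K+2`); `6K` steps, `K` top contacts (the odd columns of
rail 2). [cite: DuminilCopinHammond2013, §2.2 (irreducible bridges); lane «pcv-sawmu» a-p2 g25 — own object] -/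
def serpDn (K : ℕ) : List HV := (serpUp K).map flipA

/-- `serpDn K` has `6K + 1` vertices. [cite: DuminilCopinHammond2013, §2.2; lane «pcv-sawmu» a-p2 g25] -/
@[simp] theorem length_serpDn (K : ℕ) : (serpDn K).length = 6 * K + 1 := by simp [serpDn]

/-- ★★ **Identification, case B.**  An irreducible self-avoiding bridge of `S₃` starting `(0,2,f) → (0,2,t)` (level 4 → the lonely
level-5 vertex of column 3) with last column `ξ_end ≥ 4` IS `serpDn K` with `ξ_end = 2K + 2` (transport of case A by `flipB`).
[cite: DuminilCopinHammond2013, §2.2 (irreducible bridges); lane «pcv-sawmu» a-p2 g25 — own result] -/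
theorem caseB_eq_serpDn (hc : l.IsChain hvGraph.Adj) (hnd : l.Nodup) (hin : InLev 3 l) (hB : IsHBridge l)
    (hirr : ∀ i, ¬ IsRenewalIdx l i) (h0 : l[0]? = some (0, 2, false)) (h1 : l[1]? = some (0, 2, true))
    (hE : 4 ≤ xi (l.getLast hB.1)) : ∃ K : ℕ, 1 ≤ K ∧ xi (l.getLast hB.1) = 2 * K + 2 ∧ l = serpDn K := by
  obtain ⟨hc', hnd', hin', hB', hirr'⟩ :=
    transport (σ := flipB) (τ := flipA) (fun _ _ => adj_flipB) flipA_flipB lev_flipB (-1) (fun v => by simp; ring) hc hnd hin hB hirr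
  have h0' : (l.map flipB)[0]? = some (0, 0, true) := by rw [List.getElem?_map, h0]; simp [flipB, bit]
  have h1' : (l.map flipB)[1]? = some (1, 0, false) := by rw [List.getElem?_map, h1]; simp [flipB, bit]
  have hlast : xi ((l.map flipB).getLast hB'.1) = xi (l.getLast hB.1) - 1 := by rw [List.getLast_map, xi_flipB]
  obtain ⟨K, hK, hKE⟩ := caseA_odd hc' hnd' hin' hB' hirr' h0' h1' (by rw [hlast]; omega)
  have heq := caseA_eq_serpUp hc' hnd' hin' hB' hirr' h0' h1' hK hKE
  refine ⟨K, hK, by rw [hlast] at hKE; omega, ?_⟩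
  rw [serpDn, ← heq, List.map_map]
  have : flipA ∘ flipB = id := funext fun v => flipA_flipB v
  rw [this, List.map_id]

/-- `serpDn K` is obtained from `serpUp K` positionwise (plumbing). [cite: DuminilCopinHammond2013, §2.2; lane plumbing] -/
theorem serpDn_at {K i : ℕ} {v : HV} (h : (serpUp K)[i]? = some v) : (serpDn K)[i]? = some (flipA v) := by
  rw [serpDn, List.getElem?_map, h]; rfl

/-- `serpDn K` has exactly `K` top contacts after its head (= the level-0 vertices of `serpUp K` after its head: the even
columns of rail 0). [cite: BeatonBousquetMelouDeGierDuminilCopinGuttmann2014, §3.2 (surface visits weighted by y); lane «pcv-sawmu» a-p2 g25] -/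
theorem topCnt_serpDn_tail (K : ℕ) : topCnt 3 (serpDn K).tail = K := by
  have h0 : ∀ K : ℕ, ((rail0L K).filter fun v => lev (flipA v) = 2 * (3 : ℕ) - 1).length = K := by
    intro K
    induction K with
    | zero => simp [rail0L]
    | succ K ih =>
      rw [rail0L, show 2 * (K + 1) = 2 * K + 1 + 1 by ring, List.range_succ, List.range_succ, List.map_append, List.map_append,
        List.filter_append, List.filter_append, List.length_append, List.length_append, ← rail0L, ih]
      simp [bit, show (2 * K) % 2 = 0 by omega, show (2 * K + 1) % 2 = 1 by omega]
  have h1 : ((rail1L K).filter fun v => lev (flipA v) = 2 * (3 : ℕ) - 1) = [] := by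
    rw [List.filter_eq_nil_iff]
    intro v hv
    obtain ⟨j, -, rfl⟩ := List.mem_map.1 hv
    split_ifs <;> simp [bit]
  have h2 : ((rail2L K).filter fun v => lev (flipA v) = 2 * (3 : ℕ) - 1) = [] := by
    rw [List.filter_eq_nil_iff]
    intro v hv
    obtain ⟨j, -, rfl⟩ := List.mem_map.1 hv
    split_ifs <;> simp [bit]
  rw [topCnt, serpDn, serpUp, List.map_cons, List.tail_cons, List.map_append, List.map_append, List.filter_append,
    List.filter_append, List.length_append, List.length_append, List.filter_map, List.filter_map, List.filter_map,
    List.length_map, List.length_map, List.length_map]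
  simp only [Function.comp_def] at *
  rw [h0, h1, h2]; simp

/-- The renewal weight of `serpDn K`: `x_c^{6K} y^K`. [cite: BeatonBousquetMelouDeGierDuminilCopinGuttmann2014, §4 (weights x^{|γ|} y^{contacts}); lane «pcv-sawmu» a-p2 g25] -/
theorem wD_serpDn (K : ℕ) (y : ℝ) : wD 3 y (serpDn K) = hexCriticalFugacity ^ (6 * K) * y ^ K := by
  rw [wD, topCnt_serpDn_tail, length_serpDn]; rfl

/-- ★★ `serpDn K` (`K ≥ 1`, `6K ≤ N`) is a member of the irreducible class `HBk 3 N 1 4 0` (one piece, level 4 → level 0).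
[cite: DuminilCopinHammond2013, §2.2 (irreducible bridges); lane «pcv-sawmu» a-p2 g25 — own result] -/
theorem serpDn_mem_HBk {K N : ℕ} (hK : 1 ≤ K) (hN : 6 * K ≤ N) : serpDn K ∈ HBk 3 N 1 4 0 := by
  obtain ⟨hc', hnd', hin', hB', hirr'⟩ :=
    transport (σ := flipA) (τ := flipB) (fun _ _ => adj_flipA) flipB_flipA lev_flipA 1 xi_flipA (serpUp_isChain K)
      (serpUp_nodup K) (serpUp_inLev K) (serpUp_isHBridge hK) (serpUp_not_isRenewalIdx hK)
  rw [HBk, mem_filter, mem_hBridgesN_iff]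
  refine ⟨⟨hc', hnd', by simp; omega, ⟨(0, 2, false), rfl, rfl⟩, hin', hB'⟩, by simp; omega, ?_, by simp [hdLev, serpDn, serpUp, flipA],
    ?_⟩
  · rw [npieces, Nat.add_eq_right, Finset.card_eq_zero, renIdxs, Finset.filter_eq_empty_iff]
    exact fun i _ => hirr' i
  · have hlast : (serpDn K).getLast (by simp [serpDn, serpUp]) = flipA (((K : ℤ) - 1, 2, true)) := by
      simp only [serpDn, List.getLast_map, serpUp_getLast hK]
    rw [ltLev, List.getLast?_eq_some_getLast (by simp [serpDn, serpUp]), Option.getD_some, hlast, lev_flipA]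
    simp [bit]

/-! ### §9 The classification of the irreducible bridges of `S₃` -/

/-- `2 → 4`: top-rail slant of the middle brick then the rung upwards. [cite: DuminilCopinHammond2013, §2.2 (irreducible bridges); lane «pcv-sawmu» a-p2 g25] -/
def irr24 : List HV := [(0, 1, false), (0, 1, true), (0, 2, false)]
/-- `4 → 5`: one right slant along the top rail, ending ON the surface. [cite: DuminilCopinHammond2013, §2.2 (irreducible bridges); lane «pcv-sawmu» a-p2 g25] -/
def irr45 : List HV := [(0, 2, false), (0, 2, true)]
/-- `5 → 4`: one right slant along the top rail. [cite: DuminilCopinHammond2013, §2.2 (irreducible bridges); lane «pcv-sawmu» a-p2 g25] -/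
def irr54 : List HV := [(0, 2, true), (1, 2, false)]
/-- `5 → 3`: top slant then the rung downwards. [cite: DuminilCopinHammond2013, §2.2 (irreducible bridges); lane «pcv-sawmu» a-p2 g25] -/
def irr53 : List HV := [(0, 2, true), (1, 2, false), (1, 1, true)]

/-- Bounds for a member of a horizontal bridge of `S₃` other than its head `v₀ = l[0]` (columns unfolded for explicit vertices;
plumbing). [cite: DuminilCopinHammond2013, §2.2; lane plumbing] -/
theorem mem_bounds (hin : InLev 3 l) (hB : IsHBridge l) {v₀ : HV} (h0 : l[0]? = some v₀) {w : HV} (hw : w ∈ l) (hne : w ≠ v₀) :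
    2 * v₀.1 + v₀.2.1 + bit v₀ < 2 * w.1 + w.2.1 + bit w ∧ 2 * w.1 + w.2.1 + bit w ≤ xi (l.getLast hB.1) ∧
      0 ≤ 2 * w.2.1 + bit w ∧ 2 * w.2.1 + bit w ≤ 5 := by
  have hh := xi_head_of_at_zero hB.1 h0
  have hb := xi_bounds_of_mem hB hw (by rw [hh]; exact hne)
  rw [hh] at hb
  have hl := hin w hw
  simp only [xi, lev] at hb hl
  push_cast at hl
  exact ⟨hb.1, hb.2, hl.1, by omega⟩

/-- The vertex after position `j` (plumbing). [cite: MadrasSlade1993, §1.1; lane plumbing] -/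
theorem at_succ (hc : l.IsChain hvGraph.Adj) {j : ℕ} {w : HV} (hj : l[j]? = some w) (hlen : j + 1 < l.length) :
    ∃ w', l[j + 1]? = some w' ∧ hvGraph.Adj w w' ∧ w' ∈ l :=
  ⟨l[j + 1], List.getElem?_eq_getElem hlen, adj_of_at hc hj (List.getElem?_eq_getElem hlen), List.getElem_mem hlen⟩

/-- A two-vertex list from its positions (plumbing). [folklore] -/
private theorem eq_pair {u v : HV} (hlen : l.length = 2) (h0 : l[0]? = some u) (h1 : l[1]? = some v) : l = [u, v] := by
  apply List.ext_getElem?; intro i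
  match i with
  | 0 => simpa using h0
  | 1 => simpa using h1
  | i + 2 => rw [List.getElem?_eq_none (by omega), List.getElem?_eq_none (by simp)]

/-- A three-vertex list from its positions (plumbing). [folklore] -/
private theorem eq_triple {u v w : HV} (hlen : l.length = 3) (h0 : l[0]? = some u) (h1 : l[1]? = some v) (h2 : l[2]? = some w) :
    l = [u, v, w] := by
  apply List.ext_getElem?; intro i
  match i with
  | 0 => simpa using h0
  | 1 => simpa using h1
  | 2 => simpa using h2
  | i + 3 => rw [List.getElem?_eq_none (by omega), List.getElem?_eq_none (by simp)]

/-- ★★★ **CLASSIFICATION of the irreducible bridges of the width-three strip.**  Every member of `HBk 3 N 1 a b` (irreducible standard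
horizontal bridge of `S₃` from level `a` to level `b`) is one of TEN short lists — `0→1`, `1→0`, `2→3`, `3→2`, `4→5`, `5→4` (one
slant), `0→2`, `2→4` (slant + rung up), `3→1`, `5→3` (slant + rung down) — or a SERPENTINE: `serpUp K` (`1 → 5`) or `serpDn K` (`4 → 0`),
`K ≥ 1`, of `6K` steps with `K` top contacts.  Proof: the vertex after the head is forced; if it is one of the two rung vertices of its
column, the lonely vertex of that column would be a dead end strictly before the last column, so the bridge ends in that column
(length `≤ 3`); otherwise §5–§8. [cite: DuminilCopinHammond2013, §2.2 (irreducible bridges); DuminilCopinSmirnov2012, §3 (Fig. 3: the strip S_T); lane «pcv-sawmu» a-p2 g25 — own result] -/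
theorem mem_HBk_three_one {N : ℕ} {a b : ℤ} {l : List HV} (hl : l ∈ HBk 3 N 1 a b) :
    (l = W2.irr01 ∧ a = 0 ∧ b = 1) ∨ (l = W2.irr02 ∧ a = 0 ∧ b = 2) ∨ (l = W2.irr10 ∧ a = 1 ∧ b = 0) ∨
    (l = W2.irr23 ∧ a = 2 ∧ b = 3) ∨ (l = irr24 ∧ a = 2 ∧ b = 4) ∨ (l = W2.irr32 ∧ a = 3 ∧ b = 2) ∨
    (l = W2.irr31 ∧ a = 3 ∧ b = 1) ∨ (l = irr45 ∧ a = 4 ∧ b = 5) ∨ (l = irr54 ∧ a = 5 ∧ b = 4) ∨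
    (l = irr53 ∧ a = 5 ∧ b = 3) ∨
    (∃ K, 1 ≤ K ∧ l = serpUp K ∧ a = 1 ∧ b = 5) ∨ (∃ K, 1 ≤ K ∧ l = serpDn K ∧ a = 4 ∧ b = 0) := by
  rw [HBk, mem_filter, mem_hBridgesN_iff] at hl
  obtain ⟨⟨hc, hnd, -, ⟨v, hv, hv0⟩, hin, hB⟩, h2, hnp, ha, hb⟩ := hl
  have hirr := W2.not_isRenewalIdx_of_npieces hnp
  have h0 : l[0]? = some v := by rw [← hv, List.head?_eq_getElem?]
  obtain ⟨x0, j0, c0⟩ := v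
  simp only at hv0
  subst hv0
  have hlv0 := hin _ (List.mem_of_getElem? h0)
  have hhead : l.head hB.1 = (0, j0, c0) := xi_head_of_at_zero hB.1 h0
  -- `a` is the head level, `b` the last level
  have ha' : a = lev ((0, j0, c0) : HV) := by rw [← ha, hdLev, hv]; rfl
  have hb' : b = lev (l.getLast hB.1) := by rw [← hb, ltLev, List.getLast?_eq_some_getLast hB.1]; rfl
  have hj0 : j0 = 0 ∨ j0 = 1 ∨ j0 = 2 := by cases c0 <;> simp [bit] at hlv0 <;> omega
  -- the second vertex
  obtain ⟨w1, h1, hadj1, hw1⟩ := at_succ hc h0 (by omega)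
  have B := fun {w : HV} (hw : w ∈ l) (hne : w ≠ ((0, j0, c0) : HV)) => mem_bounds hin hB h0 hw hne
  rcases hj0 with rfl | rfl | rfl <;> cases c0
  · ---------------------------------------------------------------- head `(0,0,f)`: level 0, column 0
    rcases W2.adj_false_iff.1 hadj1 with rfl | rfl | rfl
    rotate_left
    · have := (B hw1 (by simp)).1; simp at this
    · have := (B hw1 (by simp)).2.2.1; simp at this
    -- `l[1] = (0,0,t)` (a rung vertex of column 1); the lonely vertex `(-1,2,t)` of column 1 forces `ξ_end = 1`
    have hE : xi (l.getLast hB.1) = 1 := by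
      have hge := (B hw1 (by simp)).2.1
      simp only [bit_true] at hge
      by_contra hne
      obtain ⟨-, -, t2⟩ := trav_odd hc hnd hin hB hirr 0 (by rw [hhead]; simp [xi]) (by omega)
      norm_num at t2
      obtain ⟨j, hj⟩ := List.mem_iff_getElem?.1 (Trav.mem t2).1
      have hj1 : 1 ≤ j := by
        by_contra h; obtain rfl : j = 0 := by omega
        rw [h0] at hj; simp at hj
      obtain ⟨-, hlast⟩ := dead_end hc hnd hj hj1 (0, 2, false) (fun w' hw' hadj => by
        rcases W2.adj_true_iff.1 hadj with rfl | rfl | rfl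
        · have := (B hw' (by simp)).1; simp at this
        · rfl
        · have := (B hw' (by simp)).2.2.2; simp at this)
      have := lt_length_of_xi_lt hB.1 hj (by simp only [bit_true]; omega)
      omega
    rcases Nat.lt_or_ge 2 l.length with h3 | h3
    · obtain ⟨w2, h2', hadj2, hw2⟩ := at_succ hc h1 h3
      rcases W2.adj_true_iff.1 hadj2 with rfl | rfl | rfl
      · have := idx_unique hnd h2' h0; omega
      · have := (B hw2 (by simp)).2.1; rw [hE] at this; simp at this
      rcases Nat.lt_or_ge 3 l.length with h4 | h4
      · obtain ⟨w3, h3', hadj3, hw3⟩ := at_succ hc h2' h4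
        rcases W2.adj_false_iff.1 hadj3 with rfl | rfl | rfl
        · have := (B hw3 (by simp)).2.1; rw [hE] at this; simp at this
        · have := (B hw3 (by simp)).1; simp at this
        · have := idx_unique hnd h3' h1; omega
      · have hl : l = W2.irr02 := eq_triple (by omega) h0 h1 h2'
        refine Or.inr (Or.inl ⟨hl, by simp [ha'], ?_⟩)
        rw [hb']; simp [hl, W2.irr02]
    · have hl : l = W2.irr01 := eq_pair (by omega) h0 h1
      refine Or.inl ⟨hl, by simp [ha'], ?_⟩
      rw [hb']; simp [hl, W2.irr01]
  · ---------------------------------------------------------------- head `(0,0,t)`: level 1, column 1 (case A)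
    rcases W2.adj_true_iff.1 hadj1 with rfl | rfl | rfl
    · have := (B hw1 (by simp)).1; simp at this
    rotate_left
    · have := (B hw1 (by simp)).1; simp at this
    -- `l[1] = (1,0,f)`, the lonely vertex of column 2
    rcases le_or_gt 3 (xi (l.getLast hB.1)) with hE | hE
    · obtain ⟨K, hK, hKE⟩ := caseA_odd hc hnd hin hB hirr h0 h1 hE
      have hl := caseA_eq_serpUp hc hnd hin hB hirr h0 h1 hK hKE
      refine Or.inr (Or.inr (Or.inr (Or.inr (Or.inr (Or.inr (Or.inr (Or.inr (Or.inr (Or.inr (Or.inl ⟨K, hK, hl, by simp [ha'], ?_⟩))))))))))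
      subst hl
      rw [hb', serpUp_getLast hK]; simp
    · have hge := (B hw1 (by simp)).2.1
      simp only [bit_false] at hge
      have hE2 : xi (l.getLast hB.1) = 2 := by omega
      rcases Nat.lt_or_ge 2 l.length with h3 | h3
      · obtain ⟨w2, h2', hadj2, hw2⟩ := at_succ hc h1 h3
        rcases W2.adj_false_iff.1 hadj2 with rfl | rfl | rfl
        · have := (B hw2 (by simp)).2.1; rw [hE2] at this; simp at this
        · have := idx_unique hnd h2' h0; omega
        · have := (B hw2 (by simp)).2.2.1; simp at this
      · have hl : l = W2.irr10 := eq_pair (by omega) h0 h1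
        refine Or.inr (Or.inr (Or.inl ⟨hl, by simp [ha'], ?_⟩))
        rw [hb']; simp [hl, W2.irr10]
  · ---------------------------------------------------------------- head `(0,1,f)`: level 2, column 1
    rcases W2.adj_false_iff.1 hadj1 with rfl | rfl | rfl
    rotate_left
    · have := (B hw1 (by simp)).1; simp at this
    · have := (B hw1 (by simp)).1; simp at this
    -- `l[1] = (0,1,t)` (rung vertex of column 2); the lonely vertex `(1,0,f)` forces `ξ_end = 2`
    have hE : xi (l.getLast hB.1) = 2 := by
      have hge := (B hw1 (by simp)).2.1
      simp only [bit_true] at hge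
      by_contra hne
      obtain ⟨t0, -, -⟩ := trav_even hc hnd hin hB hirr 1 (by rw [hhead]; simp [xi]) (by omega)
      obtain ⟨j, hj⟩ := List.mem_iff_getElem?.1 (Trav.mem t0).1
      have hj1 : 1 ≤ j := by
        by_contra h; obtain rfl : j = 0 := by omega
        rw [h0] at hj; simp at hj
      obtain ⟨-, hlast⟩ := dead_end hc hnd hj hj1 (1, 0, true) (fun w' hw' hadj => by
        rcases W2.adj_false_iff.1 hadj with rfl | rfl | rfl
        · rfl
        · have := (B hw' (by simp)).1; simp at this
        · have := (B hw' (by simp)).2.2.1; simp at this)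
      have := lt_length_of_xi_lt hB.1 hj (by simp only [bit_false]; omega)
      omega
    rcases Nat.lt_or_ge 2 l.length with h3 | h3
    · obtain ⟨w2, h2', hadj2, hw2⟩ := at_succ hc h1 h3
      rcases W2.adj_true_iff.1 hadj2 with rfl | rfl | rfl
      · have := idx_unique hnd h2' h0; omega
      · have := (B hw2 (by simp)).2.1; rw [hE] at this; simp at this
      rcases Nat.lt_or_ge 3 l.length with h4 | h4
      · obtain ⟨w3, h3', hadj3, hw3⟩ := at_succ hc h2' h4
        rcases W2.adj_false_iff.1 hadj3 with rfl | rfl | rfl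
        · have := (B hw3 (by simp)).2.1; rw [hE] at this; simp at this
        · have := (B hw3 (by simp)).1; simp at this
        · have := idx_unique hnd h3' h1; omega
      · have hl : l = irr24 := eq_triple (by omega) h0 h1 h2'
        refine Or.inr (Or.inr (Or.inr (Or.inr (Or.inl ⟨hl, by simp [ha'], ?_⟩))))
        rw [hb']; simp [hl, irr24]
    · have hl : l = W2.irr23 := eq_pair (by omega) h0 h1
      refine Or.inr (Or.inr (Or.inr (Or.inl ⟨hl, by simp [ha'], ?_⟩)))
      rw [hb']; simp [hl, W2.irr23]
  · ---------------------------------------------------------------- head `(0,1,t)`: level 3, column 2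
    rcases W2.adj_true_iff.1 hadj1 with rfl | rfl | rfl
    · have := (B hw1 (by simp)).1; simp at this
    rotate_left
    · have := (B hw1 (by simp)).1; simp at this
    -- `l[1] = (1,1,f)` (rung vertex of column 3); the lonely vertex `(0,2,t)` forces `ξ_end = 3`
    have hE : xi (l.getLast hB.1) = 3 := by
      have hge := (B hw1 (by simp)).2.1
      simp only [bit_false] at hge
      by_contra hne
      obtain ⟨-, -, t2⟩ := trav_odd hc hnd hin hB hirr 1 (by rw [hhead]; simp [xi]) (by omega)
      norm_num at t2
      obtain ⟨j, hj⟩ := List.mem_iff_getElem?.1 (Trav.mem t2).1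
      have hj1 : 1 ≤ j := by
        by_contra h; obtain rfl : j = 0 := by omega
        rw [h0] at hj; simp at hj
      obtain ⟨-, hlast⟩ := dead_end hc hnd hj hj1 (1, 2, false) (fun w' hw' hadj => by
        rcases W2.adj_true_iff.1 hadj with rfl | rfl | rfl
        · have := (B hw' (by simp)).1; simp at this
        · rfl
        · have := (B hw' (by simp)).2.2.2; simp at this)
      have := lt_length_of_xi_lt hB.1 hj (by simp only [bit_true]; omega)
      omega
    rcases Nat.lt_or_ge 2 l.length with h3 | h3
    · obtain ⟨w2, h2', hadj2, hw2⟩ := at_succ hc h1 h3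
      rcases W2.adj_false_iff.1 hadj2 with rfl | rfl | rfl
      · have := (B hw2 (by simp)).2.1; rw [hE] at this; simp at this
      · have := idx_unique hnd h2' h0; omega
      rcases Nat.lt_or_ge 3 l.length with h4 | h4
      · obtain ⟨w3, h3', hadj3, hw3⟩ := at_succ hc h2' h4
        rcases W2.adj_true_iff.1 hadj3 with rfl | rfl | rfl
        · have := (B hw3 (by simp)).1; simp at this
        · have := (B hw3 (by simp)).2.1; rw [hE] at this; simp at this
        · have := idx_unique hnd h3' h1; omega
      · have hl : l = W2.irr31 := eq_triple (by omega) h0 h1 h2'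
        refine Or.inr (Or.inr (Or.inr (Or.inr (Or.inr (Or.inr (Or.inl ⟨hl, by simp [ha'], ?_⟩))))))
        rw [hb']; simp [hl, W2.irr31]
    · have hl : l = W2.irr32 := eq_pair (by omega) h0 h1
      refine Or.inr (Or.inr (Or.inr (Or.inr (Or.inr (Or.inl ⟨hl, by simp [ha'], ?_⟩)))))
      rw [hb']; simp [hl, W2.irr32]
  · ---------------------------------------------------------------- head `(0,2,f)`: level 4, column 2 (case B)
    rcases W2.adj_false_iff.1 hadj1 with rfl | rfl | rfl
    rotate_left
    · have := (B hw1 (by simp)).1; simp at this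
    · have := (B hw1 (by simp)).1; simp at this
    -- `l[1] = (0,2,t)`, the lonely vertex of column 3
    rcases le_or_gt 4 (xi (l.getLast hB.1)) with hE | hE
    · obtain ⟨K, hK, hKE, hl⟩ := caseB_eq_serpDn hc hnd hin hB hirr h0 h1 hE
      refine Or.inr (Or.inr (Or.inr (Or.inr (Or.inr (Or.inr (Or.inr (Or.inr (Or.inr (Or.inr (Or.inr ⟨K, hK, hl, by simp [ha'], ?_⟩))))))))))
      subst hl
      have hlast : (serpDn K).getLast hB.1 = flipA (((K : ℤ) - 1, 2, true)) := by
        simp only [serpDn, List.getLast_map, serpUp_getLast hK]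
      rw [hb', hlast, lev_flipA]; simp
    · have hge := (B hw1 (by simp)).2.1
      simp only [bit_true] at hge
      have hE3 : xi (l.getLast hB.1) = 3 := by omega
      rcases Nat.lt_or_ge 2 l.length with h3 | h3
      · obtain ⟨w2, h2', hadj2, hw2⟩ := at_succ hc h1 h3
        rcases W2.adj_true_iff.1 hadj2 with rfl | rfl | rfl
        · have := idx_unique hnd h2' h0; omega
        · have := (B hw2 (by simp)).2.1; rw [hE3] at this; simp at this
        · have := (B hw2 (by simp)).2.2.2; simp at this
      · have hl : l = irr45 := eq_pair (by omega) h0 h1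
        refine Or.inr (Or.inr (Or.inr (Or.inr (Or.inr (Or.inr (Or.inr (Or.inl ⟨hl, by simp [ha'], ?_⟩)))))))
        rw [hb']; simp [hl, irr45]
  · ---------------------------------------------------------------- head `(0,2,t)`: level 5, column 3
    rcases W2.adj_true_iff.1 hadj1 with rfl | rfl | rfl
    · have := (B hw1 (by simp)).1; simp at this
    rotate_left
    · have := (B hw1 (by simp)).2.2.2; simp at this
    -- `l[1] = (1,2,f)` (rung vertex of column 4); the lonely vertex `(2,0,f)` forces `ξ_end = 4`
    have hE : xi (l.getLast hB.1) = 4 := by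
      have hge := (B hw1 (by simp)).2.1
      simp only [bit_false] at hge
      by_contra hne
      obtain ⟨t0, -, -⟩ := trav_even hc hnd hin hB hirr 2 (by rw [hhead]; simp [xi]) (by omega)
      obtain ⟨j, hj⟩ := List.mem_iff_getElem?.1 (Trav.mem t0).1
      have hj1 : 1 ≤ j := by
        by_contra h; obtain rfl : j = 0 := by omega
        rw [h0] at hj; simp at hj
      obtain ⟨-, hlast⟩ := dead_end hc hnd hj hj1 (2, 0, true) (fun w' hw' hadj => by
        rcases W2.adj_false_iff.1 hadj with rfl | rfl | rfl
        · rfl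
        · have := (B hw' (by simp)).1; simp at this
        · have := (B hw' (by simp)).2.2.1; simp at this)
      have := lt_length_of_xi_lt hB.1 hj (by simp only [bit_false]; omega)
      omega
    rcases Nat.lt_or_ge 2 l.length with h3 | h3
    · obtain ⟨w2, h2', hadj2, hw2⟩ := at_succ hc h1 h3
      rcases W2.adj_false_iff.1 hadj2 with rfl | rfl | rfl
      · have := (B hw2 (by simp)).2.1; rw [hE] at this; simp at this
      · have := idx_unique hnd h2' h0; omega
      rcases Nat.lt_or_ge 3 l.length with h4 | h4
      · obtain ⟨w3, h3', hadj3, hw3⟩ := at_succ hc h2' h4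
        rcases W2.adj_true_iff.1 hadj3 with rfl | rfl | rfl
        · have := (B hw3 (by simp)).1; simp at this
        · have := (B hw3 (by simp)).2.1; rw [hE] at this; simp at this
        · have := idx_unique hnd h3' h1; omega
      · have hl : l = irr53 := eq_triple (by omega) h0 h1 h2'
        refine Or.inr (Or.inr (Or.inr (Or.inr (Or.inr (Or.inr (Or.inr (Or.inr (Or.inr (Or.inl ⟨hl, by simp [ha'], ?_⟩)))))))))
        rw [hb']; simp [hl, irr53]
    · have hl : l = irr54 := eq_pair (by omega) h0 h1
      refine Or.inr (Or.inr (Or.inr (Or.inr (Or.inr (Or.inr (Or.inr (Or.inr (Or.inl ⟨hl, by simp [ha'], ?_⟩))))))))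
      rw [hb']; simp [hl, irr54]

/-! ### §10 The level classes of `S₃` as explicit finsets and the kernel in closed form -/

/-- The six one-step lists are irreducible standard bridges of `S₃` (`N ≥ 1`). [cite: DuminilCopinHammond2013, §2.2; lane «pcv-sawmu» a-p2 g25] -/
theorem irr_pair_mem {N : ℕ} (hN : 1 ≤ N) :
    W2.irr01 ∈ HBk 3 N 1 0 1 ∧ W2.irr10 ∈ HBk 3 N 1 1 0 ∧ W2.irr23 ∈ HBk 3 N 1 2 3 ∧ W2.irr32 ∈ HBk 3 N 1 3 2 ∧
      irr45 ∈ HBk 3 N 1 4 5 ∧ irr54 ∈ HBk 3 N 1 5 4 := by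
  refine ⟨?_, ?_, ?_, ?_, ?_, ?_⟩
  · simpa [W2.irr01, bit] using pair_mem_HBk (T := 3) hN (W2.adj_00f.2 (Or.inl rfl)) rfl (by norm_num [xi, bit])
      (by norm_num [bit]) (by norm_num [bit])
  · simpa [W2.irr10, bit] using pair_mem_HBk (T := 3) hN (W2.adj_00t.2 (Or.inr (Or.inl rfl))) rfl (by norm_num [xi, bit])
      (by norm_num [bit]) (by norm_num [bit])
  · simpa [W2.irr23, bit] using pair_mem_HBk (T := 3) hN (W2.adj_01f.2 (Or.inl rfl)) rfl (by norm_num [xi, bit])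
      (by norm_num [bit]) (by norm_num [bit])
  · simpa [W2.irr32, bit] using pair_mem_HBk (T := 3) hN (W2.adj_01t.2 (Or.inr (Or.inl rfl))) rfl (by norm_num [xi, bit])
      (by norm_num [bit]) (by norm_num [bit])
  · simpa [irr45, bit] using pair_mem_HBk (T := 3) hN (u := (0, 2, false)) (v := (0, 2, true)) (W2.adj_false_iff.2 (Or.inl rfl)) rfl
      (by norm_num [xi, bit]) (by norm_num [bit]) (by norm_num [bit])
  · simpa [irr54, bit] using pair_mem_HBk (T := 3) hN (u := (0, 2, true)) (v := (1, 2, false)) (W2.adj_true_iff.2 (Or.inr (Or.inl rfl)))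
      rfl (by norm_num [xi, bit]) (by norm_num [bit]) (by norm_num [bit])

/-- The four rung lists are irreducible standard bridges of `S₃` (`N ≥ 2`). [cite: DuminilCopinHammond2013, §2.2; lane «pcv-sawmu» a-p2 g25] -/
theorem irr_triple_mem {N : ℕ} (hN : 2 ≤ N) :
    W2.irr02 ∈ HBk 3 N 1 0 2 ∧ W2.irr31 ∈ HBk 3 N 1 3 1 ∧ irr24 ∈ HBk 3 N 1 2 4 ∧ irr53 ∈ HBk 3 N 1 5 3 := by
  refine ⟨?_, ?_, ?_, ?_⟩
  · simpa [W2.irr02, bit] using triple_mem_HBk (T := 3) hN (W2.adj_00f.2 (Or.inl rfl)) (W2.adj_00t.2 (Or.inr (Or.inr rfl))) rfl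
      (by norm_num [xi, bit]) (by norm_num [xi, bit]) (by norm_num [bit]) (by norm_num [bit]) (by norm_num [bit]) (by norm_num [bit])
  · simpa [W2.irr31, bit] using triple_mem_HBk (T := 3) hN (W2.adj_01t.2 (Or.inr (Or.inl rfl))) (W2.adj_11f.2 (Or.inr (Or.inr rfl))) rfl
      (by norm_num [xi, bit]) (by norm_num [xi, bit]) (by norm_num [bit]) (by norm_num [bit]) (by norm_num [bit]) (by norm_num [bit])
  · simpa [irr24, bit] using triple_mem_HBk (T := 3) hN (u := (0, 1, false)) (v := (0, 1, true)) (w := (0, 2, false))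
      (W2.adj_false_iff.2 (Or.inl rfl)) (W2.adj_true_iff.2 (Or.inr (Or.inr rfl))) rfl
      (by norm_num [xi, bit]) (by norm_num [xi, bit]) (by norm_num [bit]) (by norm_num [bit]) (by norm_num [bit]) (by norm_num [bit])
  · simpa [irr53, bit] using triple_mem_HBk (T := 3) hN (u := (0, 2, true)) (v := (1, 2, false)) (w := (1, 1, true))
      (W2.adj_true_iff.2 (Or.inr (Or.inl rfl))) (W2.adj_false_iff.2 (Or.inr (Or.inr rfl))) rfl
      (by norm_num [xi, bit]) (by norm_num [xi, bit]) (by norm_num [bit]) (by norm_num [bit]) (by norm_num [bit]) (by norm_num [bit])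

/-- ★ The one-step classes of `S₃` are singletons (`N ≥ 1`). [cite: DuminilCopinHammond2013, §2.2; lane «pcv-sawmu» a-p2 g25] -/
theorem HBk_three_pair {N : ℕ} (hN : 1 ≤ N) :
    HBk 3 N 1 0 1 = {W2.irr01} ∧ HBk 3 N 1 1 0 = {W2.irr10} ∧ HBk 3 N 1 2 3 = {W2.irr23} ∧ HBk 3 N 1 3 2 = {W2.irr32} ∧
      HBk 3 N 1 4 5 = {irr45} ∧ HBk 3 N 1 5 4 = {irr54} := by
  obtain ⟨h1, h2, h3, h4, h5, h6⟩ := irr_pair_mem hN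
  refine ⟨?_, ?_, ?_, ?_, ?_, ?_⟩ <;> ext l <;> rw [mem_singleton] <;> constructor <;>
    first
    | (rintro rfl; assumption)
    | (intro hl; rcases mem_HBk_three_one hl with h | h | h | h | h | h | h | h | h | h | ⟨K, -, -, h⟩ | ⟨K, -, -, h⟩ <;>
        first | exact h.1 | norm_num at h)

/-- ★ The rung classes of `S₃` are singletons (`N ≥ 2`). [cite: DuminilCopinHammond2013, §2.2; lane «pcv-sawmu» a-p2 g25] -/
theorem HBk_three_triple {N : ℕ} (hN : 2 ≤ N) :
    HBk 3 N 1 0 2 = {W2.irr02} ∧ HBk 3 N 1 3 1 = {W2.irr31} ∧ HBk 3 N 1 2 4 = {irr24} ∧ HBk 3 N 1 5 3 = {irr53} := by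
  obtain ⟨h1, h2, h3, h4⟩ := irr_triple_mem hN
  refine ⟨?_, ?_, ?_, ?_⟩ <;> ext l <;> rw [mem_singleton] <;> constructor <;>
    first
    | (rintro rfl; assumption)
    | (intro hl; rcases mem_HBk_three_one hl with h | h | h | h | h | h | h | h | h | h | ⟨K, -, -, h⟩ | ⟨K, -, -, h⟩ <;>
        first | exact h.1 | norm_num at h)

/-- The rung classes are empty below `N = 2`. [cite: DuminilCopinHammond2013, §2.2; lane plumbing] -/
theorem HBk_three_triple_lt {N : ℕ} (hN : N < 2) :
    HBk 3 N 1 0 2 = ∅ ∧ HBk 3 N 1 3 1 = ∅ ∧ HBk 3 N 1 2 4 = ∅ ∧ HBk 3 N 1 5 3 = ∅ := by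
  refine ⟨?_, ?_, ?_, ?_⟩ <;> rw [Finset.eq_empty_iff_forall_notMem] <;> intro l hl <;> have hlen := W2.length_le_of_mem_HBk hl <;>
    rcases mem_HBk_three_one hl with h | h | h | h | h | h | h | h | h | h | ⟨K, -, -, h⟩ | ⟨K, -, -, h⟩ <;>
    first | (obtain ⟨rfl, -, -⟩ := h; simp [W2.irr02, W2.irr31, irr24, irr53] at hlen; omega) | norm_num at h

/-- ★★ The serpentine classes: `HBk 3 N 1 1 5 = {serpUp K : 1 ≤ K ≤ N/6}` and `HBk 3 N 1 4 0 = {serpDn K : 1 ≤ K ≤ N/6}`.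
[cite: DuminilCopinHammond2013, §2.2 (irreducible bridges); lane «pcv-sawmu» a-p2 g25 — own result] -/
theorem HBk_three_serp (N : ℕ) :
    HBk 3 N 1 1 5 = (Finset.range (N / 6)).image (fun K => serpUp (K + 1)) ∧
      HBk 3 N 1 4 0 = (Finset.range (N / 6)).image (fun K => serpDn (K + 1)) := by
  constructor
  · ext l
    rw [mem_image]
    constructor
    · intro hl
      have hlen := W2.length_le_of_mem_HBk hl
      rcases mem_HBk_three_one hl with h | h | h | h | h | h | h | h | h | h | ⟨K, hK, rfl, -⟩ | ⟨K, -, -, h⟩ <;>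
        first
        | norm_num at h
        | (obtain ⟨K, rfl⟩ : ∃ n, K = n + 1 := ⟨K - 1, by omega⟩
           exact ⟨K, mem_range.2 (by rw [length_serpUp] at hlen; omega), rfl⟩)
    · rintro ⟨K, hK, rfl⟩
      rw [mem_range] at hK
      exact serpUp_mem_HBk (by omega) (by omega)
  · ext l
    rw [mem_image]
    constructor
    · intro hl
      have hlen := W2.length_le_of_mem_HBk hl
      rcases mem_HBk_three_one hl with h | h | h | h | h | h | h | h | h | h | ⟨K, -, -, h⟩ | ⟨K, hK, rfl, -⟩ <;>
        first
        | norm_num at h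
        | (obtain ⟨K, rfl⟩ : ∃ n, K = n + 1 := ⟨K - 1, by omega⟩
           exact ⟨K, mem_range.2 (by rw [length_serpDn] at hlen; omega), rfl⟩)
    · rintro ⟨K, hK, rfl⟩
      rw [mem_range] at hK
      exact serpDn_mem_HBk (by omega) (by omega)

/-- The other 24 level classes of `S₃` are empty. [cite: DuminilCopinHammond2013, §2.2; lane «pcv-sawmu» a-p2 g25] -/
theorem HBk_three_empty {N : ℕ} {a b : ℤ}
    (h : ¬ ((a = 0 ∧ b = 1) ∨ (a = 0 ∧ b = 2) ∨ (a = 1 ∧ b = 0) ∨ (a = 2 ∧ b = 3) ∨ (a = 2 ∧ b = 4) ∨ (a = 3 ∧ b = 2) ∨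
      (a = 3 ∧ b = 1) ∨ (a = 4 ∧ b = 5) ∨ (a = 5 ∧ b = 4) ∨ (a = 5 ∧ b = 3) ∨ (a = 1 ∧ b = 5) ∨ (a = 4 ∧ b = 0))) :
    HBk 3 N 1 a b = ∅ := by
  rw [Finset.eq_empty_iff_forall_notMem]
  intro l hl
  apply h
  rcases mem_HBk_three_one hl with ⟨-, hh⟩ | ⟨-, hh⟩ | ⟨-, hh⟩ | ⟨-, hh⟩ | ⟨-, hh⟩ | ⟨-, hh⟩ | ⟨-, hh⟩ | ⟨-, hh⟩ | ⟨-, hh⟩ | ⟨-, hh⟩ |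
      ⟨K, -, -, hh⟩ | ⟨K, -, -, hh⟩
  · exact Or.inl hh
  · exact Or.inr (Or.inl hh)
  · exact Or.inr (Or.inr (Or.inl hh))
  · exact Or.inr (Or.inr (Or.inr (Or.inl hh)))
  · exact Or.inr (Or.inr (Or.inr (Or.inr (Or.inl hh))))
  · exact Or.inr (Or.inr (Or.inr (Or.inr (Or.inr (Or.inl hh)))))
  · exact Or.inr (Or.inr (Or.inr (Or.inr (Or.inr (Or.inr (Or.inl hh))))))
  · exact Or.inr (Or.inr (Or.inr (Or.inr (Or.inr (Or.inr (Or.inr (Or.inl hh)))))))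
  · exact Or.inr (Or.inr (Or.inr (Or.inr (Or.inr (Or.inr (Or.inr (Or.inr (Or.inl hh))))))))
  · exact Or.inr (Or.inr (Or.inr (Or.inr (Or.inr (Or.inr (Or.inr (Or.inr (Or.inr (Or.inl hh)))))))))
  · exact Or.inr (Or.inr (Or.inr (Or.inr (Or.inr (Or.inr (Or.inr (Or.inr (Or.inr (Or.inr (Or.inl hh))))))))))
  · exact Or.inr (Or.inr (Or.inr (Or.inr (Or.inr (Or.inr (Or.inr (Or.inr (Or.inr (Or.inr (Or.inr hh))))))))))

/-- The weights of the ten short lists of `S₃`: `x` (five slants), `x·y` (`4 → 5`, ending on the surface), `x²` (four rung lists).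
[cite: BeatonBousquetMelouDeGierDuminilCopinGuttmann2014, §4 (weights x^{|γ|} y^{contacts}); lane plumbing] -/
theorem wD_irr (y : ℝ) :
    wD 3 y W2.irr01 = hexCriticalFugacity ∧ wD 3 y W2.irr10 = hexCriticalFugacity ∧ wD 3 y W2.irr23 = hexCriticalFugacity ∧
      wD 3 y W2.irr32 = hexCriticalFugacity ∧ wD 3 y irr54 = hexCriticalFugacity ∧ wD 3 y irr45 = hexCriticalFugacity * y ∧
      wD 3 y W2.irr02 = hexCriticalFugacity ^ 2 ∧ wD 3 y W2.irr31 = hexCriticalFugacity ^ 2 ∧ wD 3 y irr24 = hexCriticalFugacity ^ 2 ∧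
      wD 3 y irr53 = hexCriticalFugacity ^ 2 := by
  simp [wD, W2.irr01, W2.irr10, W2.irr23, W2.irr32, W2.irr02, W2.irr31, irr24, irr45, irr54, irr53, topCnt, bit]

/-- The serpentine series truncated at `N` vertices: `s_N(y) = Σ_{1 ≤ K ≤ N/6} x_c^{6K} y^K`. [cite: DuminilCopinHammond2013, §2.2; lane «pcv-sawmu» a-p2 g25] -/
def serpSum (N : ℕ) (y : ℝ) : ℝ := ∑ K ∈ Finset.range (N / 6), (hexCriticalFugacity ^ 6 * y) ^ (K + 1)

/-- ★★ **The irreducible kernel of `S₃`**, with `x = x_c` and a parameter `s` at the serpentine entries `(1,5)`, `(4,0)`: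
`K₃(s; y) = (0,x,x²,0,0,0 | x,0,0,0,0,s | 0,0,0,x,x²,0 | 0,x²,x,0,0,0 | s,0,0,0,0,xy | 0,0,0,x²,x,0)` (rows = start level).
[cite: DuminilCopinHammond2013, §2.2 (irreducible bridges); lane «pcv-sawmu» a-p2 g25 — own result] -/
def kerThree (s y : ℝ) : Matrix (Fin (2 * 3)) (Fin (2 * 3)) ℝ :=
  Matrix.of ![![0, hexCriticalFugacity, hexCriticalFugacity ^ 2, 0, 0, 0], ![hexCriticalFugacity, 0, 0, 0, 0, s],
    ![0, 0, 0, hexCriticalFugacity, hexCriticalFugacity ^ 2, 0], ![0, hexCriticalFugacity ^ 2, hexCriticalFugacity, 0, 0, 0],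
    ![s, 0, 0, 0, 0, hexCriticalFugacity * y], ![0, 0, 0, hexCriticalFugacity ^ 2, hexCriticalFugacity, 0]]

/-- The serpentine class sums (plumbing). [cite: DuminilCopinHammond2013, §2.2; lane «pcv-sawmu» a-p2 g25] -/
theorem sum_serp (N : ℕ) (y : ℝ) :
    ∑ l ∈ HBk 3 N 1 1 5, wD 3 y l = serpSum N y ∧ ∑ l ∈ HBk 3 N 1 4 0, wD 3 y l = serpSum N y := by
  obtain ⟨h15, h40⟩ := HBk_three_serp N
  constructor
  · rw [h15, Finset.sum_image (fun K _ K' _ h => by have := congrArg List.length h; simp at this; omega)]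
    exact Finset.sum_congr rfl fun K _ => by rw [wD_serpUp, mul_pow, ← pow_mul]
  · rw [h40, Finset.sum_image (fun K _ K' _ h => by have := congrArg List.length h; simp at this; omega)]
    exact Finset.sum_congr rfl fun K _ => by rw [wD_serpDn, mul_pow, ← pow_mul]

/-- ★★ **`Imat 3 N y = K₃(s_N(y); y)`** for every truncation `N ≥ 2`: the truncated irreducible kernels of `S₃` differ only in the
serpentine entry `s_N(y) = Σ_{K ≤ N/6} x_c^{6K} y^K`. [cite: DuminilCopinHammond2013, §2.2; lane «pcv-sawmu» a-p2 g25 — own result] -/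
theorem Imat_three_eq {N : ℕ} (hN : 2 ≤ N) (y : ℝ) : Imat 3 N y = kerThree (serpSum N y) y := by
  obtain ⟨h01, h10, h23, h32, h45, h54⟩ := HBk_three_pair (by omega : 1 ≤ N)
  obtain ⟨h02, h31, h24, h53⟩ := HBk_three_triple hN
  obtain ⟨s15, s40⟩ := sum_serp N y
  obtain ⟨w01, w10, w23, w32, w54, w45, w02, w31, w24, w53⟩ := wD_irr y
  ext a b
  fin_cases a <;> fin_cases b <;>
    simp [Imat, Dk, kerThree, h01, h10, h23, h32, h45, h54, h02, h31, h24, h53, s15, s40, w01, w10, w23, w32, w54, w45, w02, w31, w24,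
      w53, HBk_three_empty]

/-- The serpentine series converges to `x_c⁶y/(1 − x_c⁶y)` for `0 ≤ y` with `x_c⁶ y < 1` (in particular on `[0, x_c^{−6}) ⊃ [0, 39]`).
[cite: DuminilCopinHammond2013, §2.2; lane «pcv-sawmu» a-p2 g25] -/
theorem tendsto_serpSum {y : ℝ} (hy : 0 ≤ y) (hy' : hexCriticalFugacity ^ 6 * y < 1) :
    Tendsto (fun N => serpSum N y) atTop (𝓝 (hexCriticalFugacity ^ 6 * y / (1 - hexCriticalFugacity ^ 6 * y))) := by
  set q : ℝ := hexCriticalFugacity ^ 6 * y with hq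
  have hq0 : 0 ≤ q := mul_nonneg (pow_nonneg hexCriticalFugacity_pos_lt_one.1.le _) hy
  have hlim : Tendsto (fun M : ℕ => ∑ K ∈ Finset.range M, q * q ^ K) atTop (𝓝 (q / (1 - q))) := by
    have h := (hasSum_geometric_of_lt_one hq0 hy').mul_left q
    rw [show q / (1 - q) = q * (1 - q)⁻¹ by rw [div_eq_mul_inv]]
    exact h.tendsto_sum_nat
  have heq : (fun N => serpSum N y) = (fun M : ℕ => ∑ K ∈ Finset.range M, q * q ^ K) ∘ (fun N => N / 6) := by
    funext N
    simp only [Function.comp_apply, serpSum]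
    exact Finset.sum_congr rfl fun K _ => by rw [hq]; ring
  rw [heq]
  exact hlim.comp (tendsto_atTop_atTop.2 fun M => ⟨6 * M, fun N hN => by omega⟩)

/-- ★★ **The irreducible kernel of the width-three strip is RATIONAL**: `Iinf 3 y = K₃(x_c⁶y/(1 − x_c⁶y); y)` for `0 ≤ y < x_c^{−6}` —
ten monomial entries and the two serpentine entries `x_c⁶y/(1 − x_c⁶y)`; in particular it is analytic far beyond the critical surface
fugacity, so every contact / length moment of the critical kernel of `S₃` is finite. [cite: DuminilCopinHammond2013, §2.2 (irreducible bridges); BeatonBousquetMelouDeGierDuminilCopinGuttmann2014, §3.2 (surface fugacity); lane «pcv-sawmu» a-p2 g25 — own result] -/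
theorem Iinf_three_eq {y : ℝ} (hy : 0 ≤ y) (hy' : hexCriticalFugacity ^ 6 * y < 1) :
    Iinf 3 y = kerThree (hexCriticalFugacity ^ 6 * y / (1 - hexCriticalFugacity ^ 6 * y)) y := by
  have hmono : ∀ a b, Monotone fun N => Imat 3 N y a b := fun a b N N' h => Imat_mono_N h hy a b
  have hlim : ∀ a b, Tendsto (fun N => Imat 3 N y a b) atTop
      (𝓝 (kerThree (hexCriticalFugacity ^ 6 * y / (1 - hexCriticalFugacity ^ 6 * y)) y a b)) := by
    intro a b
    have hev : (fun N => kerThree (serpSum N y) y a b) =ᶠ[atTop] fun N => Imat 3 N y a b :=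
      eventually_atTop.2 ⟨2, fun N hN => by simp only [Imat_three_eq hN]⟩
    refine Tendsto.congr' hev ?_
    have hs := tendsto_serpSum hy hy'
    fin_cases a <;> fin_cases b <;> simp [kerThree] <;> exact hs
  ext a b
  simp only [Iinf]
  exact tendsto_nhds_unique (tendsto_atTop_ciSup (hmono a b) ⟨_, by
    rintro _ ⟨N, rfl⟩; exact (hmono a b).ge_of_tendsto (hlim a b) N⟩) (hlim a b)

end W3

end HV

end Literature.Probability.RandomPlanarGeometry.SAW
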